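import Literature.Probability.Percolation.ZdFiveArmPointBoundOfSeparation
import Literature.Probability.Percolation.ZdFiveArmMonotone
import HarnessLib

/-!
# Quasi-multiplicativity of the five-arm probability on `ℤ²` from Kesten's separation theorem

Topic `Literature/Probability/Percolation`; critical bond percolation on `ℤ²`.  Step `(Q)` of the
printed proof of `P[𝒜₅(A_{m,n})] ≍ (m/n)²` (`DuminilCopinManolescuTassion2021_zdFiveArm_upperBound`,
`ZdFiveArmUpperBound.lean`), as a CONDITIONAL theorem: from Kesten's arm-separation lower bound
(hypothesis `hsep`, as in `ZdFiveArmPointBoundOfSeparation.lean`) and an a-priori five-arm lower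
bound at well-spaced radii (hypothesis `h5`, the RSW input of Nolin 2008, Thm. 24 (ii)), the
quasi-multiplicativity `c · P(T̃(m₁,m)) · P(T̃(m,n)) ≤ P(T̃(m₁,n))` (`m₁ ≤ m ≤ n`) of Nolin 2008,
Prop. 12 (ii) / Prop. 16, DMT 2021 Prop. 6.3, for `T̃ = zdFiveArmClusters`.

The gluing (Kesten 1987, (2.43); Nolin 2008, Prop. 12 (ii), Fig. 8): the well-separated events
`zdFiveArmSep m₁ M` and `zdFiveArmSep (8M) n` are joined, inside `A_{M,8M}`, by seven open
corridor crossings (an L-shaped corridor of three rectangles for each right arm, whose landing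
heights scale with the radius, and one straight band for the left arm) and two straight
closed-dual corridors; generalised FKG (`bondPercolation_locallyMonotone_fkg`), RSW, and the
independence of the two separated events give the probability bound (`real_qGlued_ge`), and the
glued event is contained in `zdFiveArmClusters m₁ n` (`qGlued_subset`): the two clusters are
distinct and the third arm is edge-disjoint from the first by the dual barrier
`not_openConnIn_sqAnnulus_of_dualArmsTB'` (`SqAnnulusDualBarrier.lean`), and from the second by
vertex-disjointness.

## References

* H. Kesten, CMP 109 (1987), Lemma 6, (2.43) [KestenScalingCMP1987].
* P. Nolin, EJP 13 (2008), §4.3 Prop. 12 (ii), §4.4 Prop. 16, §5.2 Thm. 24 [Nolin2008].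
* H. Duminil-Copin, I. Manolescu, V. Tassion, PTRF 181 (2021), §6.2 Prop. 6.3
  [DuminilCopinManolescuTassion2021].

Tree: `ZdFiveArmPointBoundOfSeparation.lean`, `ZdFiveArmSeparatedGluing.lean`,
`ZdFiveArmSeparated.lean`, `SqAnnulusDualBarrier.lean`, `ZdFiveArmMonotone.lean`
(`real_zdFiveArmClusters_mono`).
-/

noncomputable section

open Set _root_.MeasureTheory

namespace Literature.Probability.Percolation

open LatticeModels SimpleGraph

/-! ### Gluing lemmas with fine supports -/

section FineGlue

variable {ω : BondConfig (Site 2)} {n N : ℕ} {lo hi lo' hi' : ℤ} {s y : Site 2}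

/-- Outer gluing, right arm, with support in the body, the outer attaching walk and the outer
fence crossing. [cite: Nolin2008, §4.3, proof of Prop. 12] -/
theorem ZdSepOpenArmR.exists_walk_of_outerCorridor_fine (A : ZdSepOpenArmR ω n N lo hi lo' hi')
    (hhi' : hi' = lo' + (N / 64 : ℕ)) (hE : 1 ≤ N / 8) (T : (zdGraph 2).Walk s y) (hs : s 0 = N + 1)
    (hy : (N : ℤ) + (N / 8 : ℕ) ≤ y 0)
    (hT : ∀ z ∈ T.support, (N : ℤ) + 1 ≤ z 0 ∧ (z 0 ≤ N + (N / 8 : ℕ) → lo' ≤ z 1 ∧ z 1 ≤ lo' + (N / 64 : ℕ))) :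
    ∃ m ∈ T.support, ∃ U : (zdGraph 2).Walk A.x m,
      (∀ z ∈ U.support, z ∈ A.W.support ∨ z ∈ A.P.support ∨ z ∈ A.V.support) ∧ ∀ e ∈ U.edges, e ∈ ω := by
  subst hhi'
  obtain ⟨q, T₁, hq, hT₁s, -⟩ := exists_prefix_reach_ge 0 T ((N : ℤ) + (N / 8 : ℕ)) (by rw [hs]; omega) hy
  have hbox : ∀ z ∈ T₁.support, (N : ℤ) + 1 ≤ z 0 ∧ z 0 ≤ N + (N / 8 : ℕ) ∧ lo' ≤ z 1 ∧ z 1 ≤ lo' + (N / 64 : ℕ) := by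
    intro z hz
    obtain ⟨h1, h2⟩ := hT₁s z hz
    obtain ⟨h3, h4⟩ := hT z h2
    exact ⟨h3, h1, h4 h1⟩
  have hz := A.hz
  obtain ⟨m, hmT, hmV⟩ := exists_mem_support_of_vFence (L := (N : ℤ) + 1) (R := (N : ℤ) + (N / 8 : ℕ))
    (B₀ := lo') (B₁ := lo' + (N / 64 : ℕ)) A.V (fun z hz => ⟨(A.hV z hz).1, (A.hV z hz).2.1⟩)
    (by rw [A.hab.1]; omega) (by rw [A.hab.2]; omega) (by omega) T₁ hs hq hbox
  obtain ⟨Uv, hUvs, hUve⟩ := exists_walk_within_support A.V A.hu hmV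
  refine ⟨m, (hT₁s m hmT).2, A.W.append (A.P.append Uv), fun z hz => ?_, fun e he => ?_⟩
  · rw [Walk.mem_support_append_iff, Walk.mem_support_append_iff] at hz
    rcases hz with hz | hz | hz
    · exact Or.inl hz
    · exact Or.inr (Or.inl hz)
    · exact Or.inr (Or.inr (hUvs z hz))
  · rw [Walk.edges_append, List.mem_append, Walk.edges_append, List.mem_append] at he
    rcases he with he | he | he
    · exact A.hWo e he
    · exact A.hPo e he
    · exact A.hVo e (hUve e he)

/-- Inner gluing, right arm, with support in the inner attaching walk and the inner fence
crossing. [cite: Nolin2008, §4.3, proof of Prop. 12] -/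
theorem ZdSepOpenArmR.exists_walk_of_innerCorridor_fine (A : ZdSepOpenArmR ω n N lo hi lo' hi')
    (hhi : hi = lo + (n / 64 : ℕ)) (he : 1 ≤ n / 8) (T : (zdGraph 2).Walk s y) (hy : y 0 + 1 = n)
    (hs : s 0 ≤ (n : ℤ) - (n / 8 : ℕ))
    (hT : ∀ z ∈ T.support, z 0 + 1 ≤ n ∧ ((n : ℤ) - (n / 8 : ℕ) ≤ z 0 → lo ≤ z 1 ∧ z 1 ≤ lo + (n / 64 : ℕ))) :
    ∃ m ∈ T.support, ∃ U : (zdGraph 2).Walk A.x m,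
      (∀ z ∈ U.support, z ∈ A.P'.support ∨ z ∈ A.V'.support) ∧ ∀ e ∈ U.edges, e ∈ ω := by
  subst hhi
  obtain ⟨q, T₁, hq, hT₁s, -⟩ :=
    exists_prefix_reach_le 0 T.reverse ((n : ℤ) - (n / 8 : ℕ)) (by omega) hs
  have hbox : ∀ z ∈ T₁.reverse.support, (n : ℤ) - (n / 8 : ℕ) ≤ z 0 ∧ z 0 ≤ (n : ℤ) - 1 ∧
      lo ≤ z 1 ∧ z 1 ≤ lo + (n / 64 : ℕ) := by
    intro z hz
    rw [Walk.support_reverse, List.mem_reverse] at hz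
    obtain ⟨h1, h2⟩ := hT₁s z hz
    rw [Walk.support_reverse, List.mem_reverse] at h2
    obtain ⟨h3, h4⟩ := hT z h2
    exact ⟨h1, by omega, h4 h1⟩
  have hx := A.hx
  obtain ⟨m, hmT, hmV⟩ := exists_mem_support_of_vFence (L := (n : ℤ) - (n / 8 : ℕ)) (R := (n : ℤ) - 1)
    (B₀ := lo) (B₁ := lo + (n / 64 : ℕ)) A.V' (fun z hz => ⟨(A.hV' z hz).1, by have := (A.hV' z hz).2.1; omega⟩)
    (by rw [A.hab'.1]; omega) (by rw [A.hab'.2]; omega) (by omega) T₁.reverse hq (by omega) hbox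
  obtain ⟨Uv, hUvs, hUve⟩ := exists_walk_within_support A.V' A.hu' hmV
  have hmT' : m ∈ T.support := by
    rw [Walk.support_reverse, List.mem_reverse] at hmT
    have := (hT₁s m hmT).2
    rwa [Walk.support_reverse, List.mem_reverse] at this
  refine ⟨m, hmT', A.P'.append Uv, fun z hz => ?_, fun e he => ?_⟩
  · rw [Walk.mem_support_append_iff] at hz
    rcases hz with hz | hz
    · exact Or.inl hz
    · exact Or.inr (hUvs z hz)
  · rw [Walk.edges_append, List.mem_append] at he
    rcases he with he | he
    · exact A.hP'o e he
    · exact A.hV'o e (hUve e he)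

/-- Outer gluing, left arm, with fine support. [cite: Nolin2008, §4.3, proof of Prop. 12] -/
theorem ZdSepOpenArmL.exists_walk_of_outerCorridor_fine (A : ZdSepOpenArmL ω n N lo hi lo' hi')
    (hhi' : hi' = lo' + (N / 64 : ℕ)) (hE : 1 ≤ N / 8) (T : (zdGraph 2).Walk s y) (hs : s 0 = -(N : ℤ) - 1)
    (hy : y 0 ≤ -(N : ℤ) - (N / 8 : ℕ))
    (hT : ∀ z ∈ T.support, z 0 ≤ -(N : ℤ) - 1 ∧ (-(N : ℤ) - (N / 8 : ℕ) ≤ z 0 → lo' ≤ z 1 ∧ z 1 ≤ lo' + (N / 64 : ℕ))) :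
    ∃ m ∈ T.support, ∃ U : (zdGraph 2).Walk A.x m,
      (∀ z ∈ U.support, z ∈ A.W.support ∨ z ∈ A.P.support ∨ z ∈ A.V.support) ∧ ∀ e ∈ U.edges, e ∈ ω := by
  subst hhi'
  obtain ⟨q, T₁, hq, hT₁s, -⟩ := exists_prefix_reach_le 0 T (-(N : ℤ) - (N / 8 : ℕ)) (by rw [hs]; omega) hy
  have hbox : ∀ z ∈ T₁.reverse.support, -(N : ℤ) - (N / 8 : ℕ) ≤ z 0 ∧ z 0 ≤ -(N : ℤ) - 1 ∧
      lo' ≤ z 1 ∧ z 1 ≤ lo' + (N / 64 : ℕ) := by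
    intro z hz
    rw [Walk.support_reverse, List.mem_reverse] at hz
    obtain ⟨h1, h2⟩ := hT₁s z hz
    obtain ⟨h3, h4⟩ := hT z h2
    exact ⟨h1, h3, h4 h1⟩
  have hz := A.hz
  obtain ⟨m, hmT, hmV⟩ := exists_mem_support_of_vFence (L := -(N : ℤ) - (N / 8 : ℕ)) (R := -(N : ℤ) - 1)
    (B₀ := lo') (B₁ := lo' + (N / 64 : ℕ)) A.V
    (fun z hz => ⟨by have := (A.hV z hz).1; omega, by have := (A.hV z hz).2.1; omega⟩)
    (by rw [A.hab.1]; omega) (by rw [A.hab.2]; omega) (by omega) T₁.reverse hq hs hbox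
  obtain ⟨Uv, hUvs, hUve⟩ := exists_walk_within_support A.V A.hu hmV
  have hmT' : m ∈ T.support := by
    rw [Walk.support_reverse, List.mem_reverse] at hmT
    exact (hT₁s m hmT).2
  refine ⟨m, hmT', A.W.append (A.P.append Uv), fun z hz => ?_, fun e he => ?_⟩
  · rw [Walk.mem_support_append_iff, Walk.mem_support_append_iff] at hz
    rcases hz with hz | hz | hz
    · exact Or.inl hz
    · exact Or.inr (Or.inl hz)
    · exact Or.inr (Or.inr (hUvs z hz))
  · rw [Walk.edges_append, List.mem_append, Walk.edges_append, List.mem_append] at he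
    rcases he with he | he | he
    · exact A.hWo e he
    · exact A.hPo e he
    · exact A.hVo e (hUve e he)

/-- Inner gluing, left arm, with fine support. [cite: Nolin2008, §4.3, proof of Prop. 12] -/
theorem ZdSepOpenArmL.exists_walk_of_innerCorridor_fine (A : ZdSepOpenArmL ω n N lo hi lo' hi')
    (hhi : hi = lo + (n / 64 : ℕ)) (he : 1 ≤ n / 8) (T : (zdGraph 2).Walk s y) (hy : y 0 = -(n : ℤ) + 1)
    (hs : -(n : ℤ) + (n / 8 : ℕ) ≤ s 0)
    (hT : ∀ z ∈ T.support, -(n : ℤ) + 1 ≤ z 0 ∧ (z 0 ≤ -(n : ℤ) + (n / 8 : ℕ) → lo ≤ z 1 ∧ z 1 ≤ lo + (n / 64 : ℕ))) :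
    ∃ m ∈ T.support, ∃ U : (zdGraph 2).Walk A.x m,
      (∀ z ∈ U.support, z ∈ A.P'.support ∨ z ∈ A.V'.support) ∧ ∀ e ∈ U.edges, e ∈ ω := by
  subst hhi
  obtain ⟨q, T₁, hq, hT₁s, -⟩ :=
    exists_prefix_reach_ge 0 T.reverse (-(n : ℤ) + (n / 8 : ℕ)) (by rw [hy]; omega) hs
  have hbox : ∀ z ∈ T₁.support, -(n : ℤ) + 1 ≤ z 0 ∧ z 0 ≤ -(n : ℤ) + (n / 8 : ℕ) ∧
      lo ≤ z 1 ∧ z 1 ≤ lo + (n / 64 : ℕ) := by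
    intro z hz
    obtain ⟨h1, h2⟩ := hT₁s z hz
    rw [Walk.support_reverse, List.mem_reverse] at h2
    obtain ⟨h3, h4⟩ := hT z h2
    exact ⟨h3, h1, h4 h1⟩
  have hx := A.hx
  obtain ⟨m, hmT, hmV⟩ := exists_mem_support_of_vFence (L := -(n : ℤ) + 1) (R := -(n : ℤ) + (n / 8 : ℕ))
    (B₀ := lo) (B₁ := lo + (n / 64 : ℕ)) A.V' (fun z hz => ⟨(A.hV' z hz).1, (A.hV' z hz).2.1⟩)
    (by rw [A.hab'.1]; omega) (by rw [A.hab'.2]; omega) (by omega) T₁ hy hq hbox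
  obtain ⟨Uv, hUvs, hUve⟩ := exists_walk_within_support A.V' A.hu' hmV
  have hmT' : m ∈ T.support := by
    have := (hT₁s m hmT).2
    rwa [Walk.support_reverse, List.mem_reverse] at this
  refine ⟨m, hmT', A.P'.append Uv, fun z hz => ?_, fun e he => ?_⟩
  · rw [Walk.mem_support_append_iff] at hz
    rcases hz with hz | hz
    · exact Or.inl hz
    · exact Or.inr (hUvs z hz)
  · rw [Walk.edges_append, List.mem_append] at he
    rcases he with he | he
    · exact A.hP'o e he
    · exact A.hV'o e (hUve e he)

end FineGlue

/-! ### Dual gluing lemmas with located crossed edges -/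

section FineGlueDual

variable {ω : BondConfig (Site 2)} {n N : ℕ} {lo hi lo' hi' : ℤ} {s y : Site 2}

/-- Outer gluing, top dual arm, with the crossed edges located in the annulus or among the edges
crossed by the OUTER fence crossing and attaching walk. [cite: Nolin2008, §4.3, proof of Prop. 12] -/
theorem ZdSepDualArmT.exists_faceWalk_of_outerCorridor_loc (A : ZdSepDualArmT ω n N lo hi lo' hi')
    (hhi' : hi' = lo' + (N / 64 : ℕ)) (hE : 1 ≤ N / 8)
    (T : (zdGraph 2).Walk s y) (hs : s 1 = N + 1) (hy : (N : ℤ) + (N / 8 : ℕ) ≤ y 1)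
    (hT : ∀ z ∈ T.support, (N : ℤ) + 1 ≤ z 1 ∧ (z 1 ≤ N + (N / 8 : ℕ) → lo' ≤ z 0 ∧ z 0 ≤ lo' + (N / 64 : ℕ))) :
    ∃ m ∈ T.support, ∃ U : (zdGraph 2).Walk A.f m,
      (∀ d ∈ U.darts, sepEdge d.fst d.snd ∉ ω) ∧
      (∀ d ∈ U.darts, ∀ v ∈ sepEdge d.fst d.snd, v ∈ sqAnnulus n N ∨ (N : ℤ) + 1 - (N / 8 : ℕ) ≤ v 1) := by
  subst hhi'
  obtain ⟨q, T₁, hq, hT₁s, -⟩ := exists_prefix_reach_ge 1 T ((N : ℤ) + (N / 8 : ℕ)) (by rw [hs]; omega) hy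
  have hbox : ∀ z ∈ T₁.support, lo' ≤ z 0 ∧ z 0 ≤ lo' + (N / 64 : ℕ) ∧ (N : ℤ) + 1 ≤ z 1 ∧ z 1 ≤ N + (N / 8 : ℕ) := by
    intro z hz
    obtain ⟨h1, h2⟩ := hT₁s z hz
    obtain ⟨h3, h4⟩ := hT z h2
    exact ⟨(h4 h1).1, (h4 h1).2, h3, h1⟩
  have hg := A.hg
  obtain ⟨m, hmT, hmC⟩ := exists_mem_support_of_hFence (L₀ := lo') (L₁ := lo' + (N / 64 : ℕ))
    (B := (N : ℤ) + 1) (B' := (N : ℤ) + (N / 8 : ℕ)) A.C (fun z hz => ⟨(A.hC z hz).2.1, (A.hC z hz).2.2⟩)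
    (by rw [A.hab.1]; omega) (by rw [A.hab.2]; omega) (by omega) T₁ hs hq hbox
  obtain ⟨Uc, hUcs, hUcd⟩ := exists_faceWalk_within_support A.C A.hu hmC
  -- located crossed edges of the pieces
  have locC : ∀ d ∈ A.C.darts, ∀ v ∈ sepEdge d.fst d.snd, (N : ℤ) + 1 - (N / 8 : ℕ) ≤ v 1 := by
    intro d hd v hv
    have h1 := (A.hC _ (A.C.dart_fst_mem_support_of_mem_darts hd)).2.1
    have := (sepEdge_apply_le hv).2.1
    have : d.fst 1 ≤ max (d.fst 1) (d.snd 1) := le_max_left _ _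
    omega
  have locP : ∀ d ∈ A.P.darts, ∀ v ∈ sepEdge d.fst d.snd, (N : ℤ) + 1 - (N / 8 : ℕ) ≤ v 1 := by
    intro d hd v hv
    have h1 := (A.hP _ (A.P.dart_fst_mem_support_of_mem_darts hd)).2
    have e1 := abs_le.1 (show |d.fst 1 - A.g 1| ≤ (N / 8 : ℕ) - 1 by omega)
    have := (sepEdge_apply_le hv).2.1
    have : d.fst 1 ≤ max (d.fst 1) (d.snd 1) := le_max_left _ _
    omega
  have hCd : ∀ d ∈ Uc.darts, sepEdge d.fst d.snd ∉ ω ∧ ∀ v ∈ sepEdge d.fst d.snd, (N : ℤ) + 1 - (N / 8 : ℕ) ≤ v 1 := by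
    intro d hd
    rcases hUcd d hd with h | h
    · exact ⟨A.hCc d h, locC d h⟩
    · refine ⟨?_, fun v hv => locC _ h v ?_⟩
      · rw [← sepEdge_dart_symm]; exact A.hCc _ h
      · rwa [sepEdge_dart_symm]
  refine ⟨m, (hT₁s m hmT).2, A.Q.append (A.P.append Uc), fun d hd => ?_, fun d hd v hv => ?_⟩
  · rw [Walk.darts_append, List.mem_append, Walk.darts_append, List.mem_append] at hd
    rcases hd with hd | hd | hd
    · exact A.hQc d hd
    · exact A.hPc d hd
    · exact (hCd d hd).1
  · rw [Walk.darts_append, List.mem_append, Walk.darts_append, List.mem_append] at hd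
    rcases hd with hd | hd | hd
    · exact Or.inl (A.hQa d hd v hv)
    · exact Or.inr (locP d hd v hv)
    · exact Or.inr ((hCd d hd).2 v hv)

/-- Inner gluing, top dual arm, with located crossed edges (rows `≥ n - 1 - n/8`). [cite: Nolin2008, §4.3, proof of Prop. 12] -/
theorem ZdSepDualArmT.exists_faceWalk_of_innerCorridor_loc (A : ZdSepDualArmT ω n N lo hi lo' hi')
    (hhi : hi = lo + (n / 64 : ℕ)) (he : 1 ≤ n / 8)
    (T : (zdGraph 2).Walk s y) (hy : y 1 + 2 = n) (hs : s 1 ≤ (n : ℤ) - 1 - (n / 8 : ℕ))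
    (hT : ∀ z ∈ T.support, z 1 + 2 ≤ n ∧ ((n : ℤ) - 1 - (n / 8 : ℕ) ≤ z 1 → lo ≤ z 0 ∧ z 0 ≤ lo + (n / 64 : ℕ))) :
    ∃ m ∈ T.support, ∃ U : (zdGraph 2).Walk A.f m,
      (∀ d ∈ U.darts, sepEdge d.fst d.snd ∉ ω) ∧
      (∀ d ∈ U.darts, ∀ v ∈ sepEdge d.fst d.snd, (n : ℤ) - 1 - (n / 8 : ℕ) ≤ v 1) := by
  subst hhi
  obtain ⟨q, T₁, hq, hT₁s, -⟩ :=
    exists_prefix_reach_le 1 T.reverse ((n : ℤ) - 1 - (n / 8 : ℕ)) (by omega) hs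
  have hbox : ∀ z ∈ T₁.reverse.support, lo ≤ z 0 ∧ z 0 ≤ lo + (n / 64 : ℕ) ∧
      (n : ℤ) - 1 - (n / 8 : ℕ) ≤ z 1 ∧ z 1 ≤ (n : ℤ) - 2 := by
    intro z hz
    rw [Walk.support_reverse, List.mem_reverse] at hz
    obtain ⟨h1, h2⟩ := hT₁s z hz
    rw [Walk.support_reverse, List.mem_reverse] at h2
    obtain ⟨h3, h4⟩ := hT z h2
    exact ⟨(h4 h1).1, (h4 h1).2, h1, by omega⟩
  have hf := A.hf
  obtain ⟨m, hmT, hmC⟩ := exists_mem_support_of_hFence (L₀ := lo) (L₁ := lo + (n / 64 : ℕ))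
    (B := (n : ℤ) - 1 - (n / 8 : ℕ)) (B' := (n : ℤ) - 2) A.C'
    (fun z hz => ⟨(A.hC' z hz).2.1, by have := (A.hC' z hz).2.2; omega⟩)
    (by rw [A.hab'.1]; omega) (by rw [A.hab'.2]; omega) (by omega) T₁.reverse hq (by omega) hbox
  obtain ⟨Uc, hUcs, hUcd⟩ := exists_faceWalk_within_support A.C' A.hu' hmC
  have locC : ∀ d ∈ A.C'.darts, ∀ v ∈ sepEdge d.fst d.snd, (n : ℤ) - 1 - (n / 8 : ℕ) ≤ v 1 := by
    intro d hd v hv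
    have h1 := (A.hC' _ (A.C'.dart_fst_mem_support_of_mem_darts hd)).2.1
    have := (sepEdge_apply_le hv).2.1
    have : d.fst 1 ≤ max (d.fst 1) (d.snd 1) := le_max_left _ _
    omega
  have locP : ∀ d ∈ A.P'.darts, ∀ v ∈ sepEdge d.fst d.snd, (n : ℤ) - 1 - (n / 8 : ℕ) ≤ v 1 := by
    intro d hd v hv
    have h1 := (A.hP' _ (A.P'.dart_fst_mem_support_of_mem_darts hd)).2
    have e1 := abs_le.1 (show |d.fst 1 - A.f 1| ≤ (n / 8 : ℕ) - 1 by omega)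
    have := (sepEdge_apply_le hv).2.1
    have : d.fst 1 ≤ max (d.fst 1) (d.snd 1) := le_max_left _ _
    omega
  have hCd : ∀ d ∈ Uc.darts, sepEdge d.fst d.snd ∉ ω ∧ ∀ v ∈ sepEdge d.fst d.snd, (n : ℤ) - 1 - (n / 8 : ℕ) ≤ v 1 := by
    intro d hd
    rcases hUcd d hd with h | h
    · exact ⟨A.hC'c d h, locC d h⟩
    · refine ⟨?_, fun v hv => locC _ h v ?_⟩
      · rw [← sepEdge_dart_symm]; exact A.hC'c _ h
      · rwa [sepEdge_dart_symm]
  have hmT' : m ∈ T.support := by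
    rw [Walk.support_reverse, List.mem_reverse] at hmT
    have := (hT₁s m hmT).2
    rwa [Walk.support_reverse, List.mem_reverse] at this
  refine ⟨m, hmT', A.P'.append Uc, fun d hd => ?_, fun d hd v hv => ?_⟩
  · rw [Walk.darts_append, List.mem_append] at hd
    rcases hd with hd | hd
    · exact A.hP'c d hd
    · exact (hCd d hd).1
  · rw [Walk.darts_append, List.mem_append] at hd
    rcases hd with hd | hd
    · exact locP d hd v hv
    · exact (hCd d hd).2 v hv

/-- Outer gluing, bottom dual arm, with located crossed edges. [cite: Nolin2008, §4.3, proof of Prop. 12] -/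
theorem ZdSepDualArmB.exists_faceWalk_of_outerCorridor_loc (A : ZdSepDualArmB ω n N lo hi lo' hi')
    (hhi' : hi' = lo' + (N / 64 : ℕ)) (hE : 1 ≤ N / 8)
    (T : (zdGraph 2).Walk s y) (hs : s 1 + 2 = -(N : ℤ)) (hy : y 1 ≤ -(N : ℤ) - 1 - (N / 8 : ℕ))
    (hT : ∀ z ∈ T.support, z 1 + 2 ≤ -(N : ℤ) ∧ (-(N : ℤ) - 1 - (N / 8 : ℕ) ≤ z 1 → lo' ≤ z 0 ∧ z 0 ≤ lo' + (N / 64 : ℕ))) :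
    ∃ m ∈ T.support, ∃ U : (zdGraph 2).Walk A.f m,
      (∀ d ∈ U.darts, sepEdge d.fst d.snd ∉ ω) ∧
      (∀ d ∈ U.darts, ∀ v ∈ sepEdge d.fst d.snd, v ∈ sqAnnulus n N ∨ v 1 ≤ -(N : ℤ) + (N / 8 : ℕ)) := by
  subst hhi'
  obtain ⟨q, T₁, hq, hT₁s, -⟩ :=
    exists_prefix_reach_le 1 T (-(N : ℤ) - 1 - (N / 8 : ℕ)) (by omega) hy
  have hbox : ∀ z ∈ T₁.reverse.support, lo' ≤ z 0 ∧ z 0 ≤ lo' + (N / 64 : ℕ) ∧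
      -(N : ℤ) - 1 - (N / 8 : ℕ) ≤ z 1 ∧ z 1 ≤ -(N : ℤ) - 2 := by
    intro z hz
    rw [Walk.support_reverse, List.mem_reverse] at hz
    obtain ⟨h1, h2⟩ := hT₁s z hz
    obtain ⟨h3, h4⟩ := hT z h2
    exact ⟨(h4 h1).1, (h4 h1).2, h1, by omega⟩
  have hg := A.hg
  obtain ⟨m, hmT, hmC⟩ := exists_mem_support_of_hFence (L₀ := lo') (L₁ := lo' + (N / 64 : ℕ))
    (B := -(N : ℤ) - 1 - (N / 8 : ℕ)) (B' := -(N : ℤ) - 2) A.C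
    (fun z hz => ⟨by have := (A.hC z hz).2.1; omega, by have := (A.hC z hz).2.2; omega⟩)
    (by rw [A.hab.1]; omega) (by rw [A.hab.2]; omega) (by omega) T₁.reverse hq (by omega) hbox
  obtain ⟨Uc, hUcs, hUcd⟩ := exists_faceWalk_within_support A.C A.hu hmC
  have locC : ∀ d ∈ A.C.darts, ∀ v ∈ sepEdge d.fst d.snd, v 1 ≤ -(N : ℤ) + (N / 8 : ℕ) := by
    intro d hd v hv
    have h1 := (A.hC _ (A.C.dart_fst_mem_support_of_mem_darts hd)).2.2
    have h2 := (A.hC _ (A.C.dart_snd_mem_support_of_mem_darts hd)).2.2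
    have := (sepEdge_apply_le hv).2.2
    have : max (d.fst 1) (d.snd 1) ≤ -(N : ℤ) - 2 := max_le (by omega) (by omega)
    omega
  have locP : ∀ d ∈ A.P.darts, ∀ v ∈ sepEdge d.fst d.snd, v 1 ≤ -(N : ℤ) + (N / 8 : ℕ) := by
    intro d hd v hv
    have h1 := (A.hP _ (A.P.dart_fst_mem_support_of_mem_darts hd)).2
    have h2 := (A.hP _ (A.P.dart_snd_mem_support_of_mem_darts hd)).2
    have e1 := abs_le.1 (show |d.fst 1 - A.g 1| ≤ (N / 8 : ℕ) - 1 by omega)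
    have e2 := abs_le.1 (show |d.snd 1 - A.g 1| ≤ (N / 8 : ℕ) - 1 by omega)
    have := (sepEdge_apply_le hv).2.2
    have : max (d.fst 1) (d.snd 1) ≤ A.g 1 + (N / 8 : ℕ) - 1 := max_le (by omega) (by omega)
    omega
  have hCd : ∀ d ∈ Uc.darts, sepEdge d.fst d.snd ∉ ω ∧ ∀ v ∈ sepEdge d.fst d.snd, v 1 ≤ -(N : ℤ) + (N / 8 : ℕ) := by
    intro d hd
    rcases hUcd d hd with h | h
    · exact ⟨A.hCc d h, locC d h⟩
    · refine ⟨?_, fun v hv => locC _ h v ?_⟩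
      · rw [← sepEdge_dart_symm]; exact A.hCc _ h
      · rwa [sepEdge_dart_symm]
  have hmT' : m ∈ T.support := by
    rw [Walk.support_reverse, List.mem_reverse] at hmT
    exact (hT₁s m hmT).2
  refine ⟨m, hmT', A.Q.append (A.P.append Uc), fun d hd => ?_, fun d hd v hv => ?_⟩
  · rw [Walk.darts_append, List.mem_append, Walk.darts_append, List.mem_append] at hd
    rcases hd with hd | hd | hd
    · exact A.hQc d hd
    · exact A.hPc d hd
    · exact (hCd d hd).1
  · rw [Walk.darts_append, List.mem_append, Walk.darts_append, List.mem_append] at hd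
    rcases hd with hd | hd | hd
    · exact Or.inl (A.hQa d hd v hv)
    · exact Or.inr (locP d hd v hv)
    · exact Or.inr ((hCd d hd).2 v hv)

/-- Inner gluing, bottom dual arm, with located crossed edges (rows `≤ -n + 1 + n/8`). [cite: Nolin2008, §4.3, proof of Prop. 12] -/
theorem ZdSepDualArmB.exists_faceWalk_of_innerCorridor_loc (A : ZdSepDualArmB ω n N lo hi lo' hi')
    (hhi : hi = lo + (n / 64 : ℕ)) (he : 1 ≤ n / 8)
    (T : (zdGraph 2).Walk s y) (hy : y 1 = -(n : ℤ) + 1) (hs : -(n : ℤ) + (n / 8 : ℕ) ≤ s 1)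
    (hT : ∀ z ∈ T.support, -(n : ℤ) + 1 ≤ z 1 ∧ (z 1 ≤ -(n : ℤ) + (n / 8 : ℕ) → lo ≤ z 0 ∧ z 0 ≤ lo + (n / 64 : ℕ))) :
    ∃ m ∈ T.support, ∃ U : (zdGraph 2).Walk A.f m,
      (∀ d ∈ U.darts, sepEdge d.fst d.snd ∉ ω) ∧
      (∀ d ∈ U.darts, ∀ v ∈ sepEdge d.fst d.snd, v 1 ≤ -(n : ℤ) + 1 + (n / 8 : ℕ)) := by
  subst hhi
  obtain ⟨q, T₁, hq, hT₁s, -⟩ :=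
    exists_prefix_reach_ge 1 T.reverse (-(n : ℤ) + (n / 8 : ℕ)) (by rw [hy]; omega) hs
  have hbox : ∀ z ∈ T₁.support, lo ≤ z 0 ∧ z 0 ≤ lo + (n / 64 : ℕ) ∧
      -(n : ℤ) + 1 ≤ z 1 ∧ z 1 ≤ -(n : ℤ) + (n / 8 : ℕ) := by
    intro z hz
    obtain ⟨h1, h2⟩ := hT₁s z hz
    rw [Walk.support_reverse, List.mem_reverse] at h2
    obtain ⟨h3, h4⟩ := hT z h2
    exact ⟨(h4 h1).1, (h4 h1).2, h3, h1⟩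
  have hf := A.hf
  obtain ⟨m, hmT, hmC⟩ := exists_mem_support_of_hFence (L₀ := lo) (L₁ := lo + (n / 64 : ℕ))
    (B := -(n : ℤ) + 1) (B' := -(n : ℤ) + (n / 8 : ℕ)) A.C'
    (fun z hz => ⟨(A.hC' z hz).2.1, (A.hC' z hz).2.2⟩)
    (by rw [A.hab'.1]; omega) (by rw [A.hab'.2]; omega) (by omega) T₁ hy hq hbox
  obtain ⟨Uc, hUcs, hUcd⟩ := exists_faceWalk_within_support A.C' A.hu' hmC
  have locC : ∀ d ∈ A.C'.darts, ∀ v ∈ sepEdge d.fst d.snd, v 1 ≤ -(n : ℤ) + 1 + (n / 8 : ℕ) := by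
    intro d hd v hv
    have h1 := (A.hC' _ (A.C'.dart_fst_mem_support_of_mem_darts hd)).2.2
    have h2 := (A.hC' _ (A.C'.dart_snd_mem_support_of_mem_darts hd)).2.2
    have := (sepEdge_apply_le hv).2.2
    have : max (d.fst 1) (d.snd 1) ≤ -(n : ℤ) + (n / 8 : ℕ) := max_le h1 h2
    omega
  have locP : ∀ d ∈ A.P'.darts, ∀ v ∈ sepEdge d.fst d.snd, v 1 ≤ -(n : ℤ) + 1 + (n / 8 : ℕ) := by
    intro d hd v hv
    have h1 := (A.hP' _ (A.P'.dart_fst_mem_support_of_mem_darts hd)).2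
    have h2 := (A.hP' _ (A.P'.dart_snd_mem_support_of_mem_darts hd)).2
    have e1 := abs_le.1 (show |d.fst 1 - A.f 1| ≤ (n / 8 : ℕ) - 1 by omega)
    have e2 := abs_le.1 (show |d.snd 1 - A.f 1| ≤ (n / 8 : ℕ) - 1 by omega)
    have := (sepEdge_apply_le hv).2.2
    have : max (d.fst 1) (d.snd 1) ≤ A.f 1 + (n / 8 : ℕ) - 1 := max_le (by omega) (by omega)
    omega
  have hCd : ∀ d ∈ Uc.darts, sepEdge d.fst d.snd ∉ ω ∧ ∀ v ∈ sepEdge d.fst d.snd, v 1 ≤ -(n : ℤ) + 1 + (n / 8 : ℕ) := by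
    intro d hd
    rcases hUcd d hd with h | h
    · exact ⟨A.hC'c d h, locC d h⟩
    · refine ⟨?_, fun v hv => locC _ h v ?_⟩
      · rw [← sepEdge_dart_symm]; exact A.hC'c _ h
      · rwa [sepEdge_dart_symm]
  have hmT' : m ∈ T.support := by
    have := (hT₁s m hmT).2
    rwa [Walk.support_reverse, List.mem_reverse] at this
  refine ⟨m, hmT', A.P'.append Uc, fun d hd => ?_, fun d hd v hv => ?_⟩
  · rw [Walk.darts_append, List.mem_append] at hd
    rcases hd with hd | hd
    · exact A.hP'c d hd
    · exact (hCd d hd).1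
  · rw [Walk.darts_append, List.mem_append] at hd
    rcases hd with hd | hd
    · exact locP d hd v hv
    · exact (hCd d hd).2 v hv

end FineGlueDual

/-! ### L-shaped corridors: three rectangle crossings give one walk -/

section LCorridor

/-- **Chaining three crossings.** An open left–right crossing `T₁` of a band `[a, X₂] × I₁`, an
open top–bottom crossing `T₂` of the column block `[X₁, X₂] × [Y₀, Y₁]` with `I₁, I₃ ⊆ [Y₀, Y₁]`
and `a ≤ X₁ ≤ X₂ ≤ b`, and an open left–right crossing `T₃` of `[X₁, b] × I₃` chain into one open
walk from the left end of `T₁` to the right end of `T₃` inside the union of the three rectangles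
(crossings of overlapping rectangles meet: the discrete Jordan lemma
`exists_mem_support_of_vFence`). [folklore] -/
theorem exists_chain3 {ω : BondConfig (Site 2)} {a X₁ X₂ b Y₀ Y₁ I₁lo I₁hi I₃lo I₃hi : ℤ}
    (hX : X₁ ≤ X₂) (haX : a ≤ X₁) (hXb : X₂ ≤ b) (hI₁ : Y₀ ≤ I₁lo ∧ I₁lo ≤ I₁hi ∧ I₁hi ≤ Y₁)
    (hI₃ : Y₀ ≤ I₃lo ∧ I₃lo ≤ I₃hi ∧ I₃hi ≤ Y₁)
    {s₁ y₁ s₂ y₂ s₃ y₃ : Site 2} (T₁ : (zdGraph 2).Walk s₁ y₁) (hs₁ : s₁ 0 = a) (hy₁ : y₁ 0 = X₂)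
    (hT₁ : ∀ z ∈ T₁.support, a ≤ z 0 ∧ z 0 ≤ X₂ ∧ I₁lo ≤ z 1 ∧ z 1 ≤ I₁hi) (hT₁e : ∀ e ∈ T₁.edges, e ∈ ω)
    (T₂ : (zdGraph 2).Walk s₂ y₂) (hs₂ : s₂ 1 = Y₀) (hy₂ : y₂ 1 = Y₁)
    (hT₂ : ∀ z ∈ T₂.support, X₁ ≤ z 0 ∧ z 0 ≤ X₂ ∧ Y₀ ≤ z 1 ∧ z 1 ≤ Y₁) (hT₂e : ∀ e ∈ T₂.edges, e ∈ ω)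
    (T₃ : (zdGraph 2).Walk s₃ y₃) (hs₃ : s₃ 0 = X₁) (hy₃ : y₃ 0 = b)
    (hT₃ : ∀ z ∈ T₃.support, X₁ ≤ z 0 ∧ z 0 ≤ b ∧ I₃lo ≤ z 1 ∧ z 1 ≤ I₃hi) (hT₃e : ∀ e ∈ T₃.edges, e ∈ ω) :
    ∃ T : (zdGraph 2).Walk s₁ y₃, (∀ e ∈ T.edges, e ∈ ω) ∧
      ∀ z ∈ T.support, z ∈ T₁.support ∨ z ∈ T₂.support ∨ z ∈ T₃.support := by
  -- `T₁` crosses the block `[X₁, X₂] × I₁` horizontally, hence meets `T₂`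
  obtain ⟨p₁, q₁, U₁, hp₁, hq₁, hU₁s, -⟩ := exists_segment_between 0 T₁ X₁ X₂ (by rw [hs₁]; exact haX)
    (by rw [hy₁]) hX
  obtain ⟨m₁, hm₁U, hm₁T₂⟩ := exists_mem_support_of_vFence (L := X₁) (R := X₂) (B₀ := I₁lo) (B₁ := I₁hi) T₂
    (fun z hz => ⟨(hT₂ z hz).1, (hT₂ z hz).2.1⟩) (by rw [hs₂]; exact hI₁.1) (by rw [hy₂]; exact hI₁.2.2) hI₁.2.1
    U₁ hp₁ hq₁ (fun z hz => ⟨(hU₁s z hz).1, (hU₁s z hz).2.1, (hT₁ z (hU₁s z hz).2.2).2.2⟩)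
  have hm₁T₁ : m₁ ∈ T₁.support := (hU₁s m₁ hm₁U).2.2
  -- `T₃` crosses the block `[X₁, X₂] × I₃` horizontally, hence meets `T₂`
  obtain ⟨p₃, q₃, U₃, hp₃, hq₃, hU₃s, -⟩ := exists_segment_between 0 T₃ X₁ X₂ (by rw [hs₃]) (by rw [hy₃]; exact hXb) hX
  obtain ⟨m₂, hm₂U, hm₂T₂⟩ := exists_mem_support_of_vFence (L := X₁) (R := X₂) (B₀ := I₃lo) (B₁ := I₃hi) T₂
    (fun z hz => ⟨(hT₂ z hz).1, (hT₂ z hz).2.1⟩) (by rw [hs₂]; exact hI₃.1) (by rw [hy₂]; exact hI₃.2.2) hI₃.2.1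
    U₃ hp₃ hq₃ (fun z hz => ⟨(hU₃s z hz).1, (hU₃s z hz).2.1, (hT₃ z (hU₃s z hz).2.2).2.2⟩)
  have hm₂T₃ : m₂ ∈ T₃.support := (hU₃s m₂ hm₂U).2.2
  obtain ⟨U₂, hU₂s, hU₂e⟩ := exists_walk_within_support T₂ hm₁T₂ hm₂T₂
  refine ⟨(T₁.takeUntil m₁ hm₁T₁).append (U₂.append (T₃.dropUntil m₂ hm₂T₃)), fun e he => ?_, fun z hz => ?_⟩
  · rw [Walk.edges_append, List.mem_append, Walk.edges_append, List.mem_append] at he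
    rcases he with he | he | he
    · exact hT₁e e (T₁.edges_takeUntil_subset_edges hm₁T₁ he)
    · exact hT₂e e (hU₂e e he)
    · exact hT₃e e (T₃.edges_dropUntil_subset_edges hm₂T₃ he)
  · rw [Walk.mem_support_append_iff, Walk.mem_support_append_iff] at hz
    rcases hz with hz | hz | hz
    · exact Or.inl (T₁.support_takeUntil_subset_support hm₁T₁ hz)
    · exact Or.inr (Or.inl (hU₂s z hz))
    · exact Or.inr (Or.inr (T₃.support_dropUntil_subset_support hm₂T₃ hz))

end LCorridor

/-! ### The extension events for `(Q)`: corridors between the scales `M` and `8M` -/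

section QEvents

/-- The translated top–bottom crossing event of `u + [0, w] × [0, h]`. [folklore] -/
def tbCrossingAt' (u : Site 2) (w h : ℕ) : Set (BondConfig (Site 2)) :=
  openCrossing ((· + u) '' (rectangle w h : Set (Site 2)))
    ((· + u) '' (bottomSide w h : Set (Site 2))) ((· + u) '' (topSide w h : Set (Site 2)))

variable (M : ℕ)

/-- **The seven open corridors of `(Q)`**: for each right arm an L-shaped corridor — a band at the
landing height `±M/4` of the inner event from the column `M + 1` to the column block
`[4M, 4M + M/8]`, that block from height `±M/4` to height `±(2M + M/8)`, and a band at the landing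
height `±2M = ±(8M)/4` of the outer event from the block to the column `8M - 1` — and a straight
band `[−8M + 1, −M − 1] × [0, M/64]` for the left arm. [cite: Nolin2008, §4.3, Prop. 12 (ii) and Fig. 8] -/
def qCorrOpen : Set (BondConfig (Site 2)) :=
  (lrCrossingAt ![(M : ℤ) + 1, (M / 4 : ℕ)] (3 * M + M / 8 - 1) (M / 64) ∩
    tbCrossingAt' ![4 * (M : ℤ), (M / 4 : ℕ)] (M / 8) (2 * M + M / 8 - M / 4) ∩
    lrCrossingAt ![4 * (M : ℤ), 2 * (M : ℤ)] (4 * M - 1) (M / 8)) ∩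
  (lrCrossingAt ![(M : ℤ) + 1, -((M / 4 : ℕ) + (M / 64 : ℕ) : ℤ)] (3 * M + M / 8 - 1) (M / 64) ∩
    tbCrossingAt' ![4 * (M : ℤ), -(2 * (M : ℤ) + (M / 8 : ℕ))] (M / 8) (2 * M + M / 8 - M / 4) ∩
    lrCrossingAt ![4 * (M : ℤ), -(2 * (M : ℤ) + (M / 8 : ℕ))] (4 * M - 1) (M / 8) ∩
    lrCrossingAt ![-(8 * (M : ℤ)) + 1, 0] (7 * M - 2) (M / 64))

/-- **The two closed-dual corridors of `(Q)`**: the face columns `[0, M/64]` from the face row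
`M + 1` up to the face row `8M - 2`, and their mirror image below. [cite: Nolin2008, §4.3, Prop. 12 (ii) and Fig. 8] -/
def qCorrDual : Set (BondConfig (Site 2)) :=
  dualFaceCrossing ![0, (M : ℤ) + 2] (M / 64 + 1) (7 * M - 4) ∩
    dualFaceCrossing ![0, -(8 * (M : ℤ)) + 2] (M / 64 + 1) (7 * M - 4)

/-- The pairs read by the open corridors of `(Q)`. [folklore] -/
def qPairsP : Finset (Sym2 (Site 2)) :=
  (((rectangle (3 * M + M / 8 - 1) (M / 64)).image (· + (![(M : ℤ) + 1, (M / 4 : ℕ)] : Site 2))).sym2 ∪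
    ((rectangle (M / 8) (2 * M + M / 8 - M / 4)).image (· + (![4 * (M : ℤ), (M / 4 : ℕ)] : Site 2))).sym2 ∪
    ((rectangle (4 * M - 1) (M / 8)).image (· + (![4 * (M : ℤ), 2 * (M : ℤ)] : Site 2))).sym2) ∪
  (((rectangle (3 * M + M / 8 - 1) (M / 64)).image (· + (![(M : ℤ) + 1, -((M / 4 : ℕ) + (M / 64 : ℕ) : ℤ)] : Site 2))).sym2 ∪
    ((rectangle (M / 8) (2 * M + M / 8 - M / 4)).image (· + (![4 * (M : ℤ), -(2 * (M : ℤ) + (M / 8 : ℕ))] : Site 2))).sym2 ∪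
    ((rectangle (4 * M - 1) (M / 8)).image (· + (![4 * (M : ℤ), -(2 * (M : ℤ) + (M / 8 : ℕ))] : Site 2))).sym2 ∪
    ((rectangle (7 * M - 2) (M / 64)).image (· + (![-(8 * (M : ℤ)) + 1, 0] : Site 2))).sym2)

/-- The pairs read by the dual corridors of `(Q)`. [folklore] -/
def qPairsM : Finset (Sym2 (Site 2)) :=
  dualFaceCrossingPairs ![0, (M : ℤ) + 2] (M / 64 + 1) (7 * M - 4) ∪
    dualFaceCrossingPairs ![0, -(8 * (M : ℤ)) + 2] (M / 64 + 1) (7 * M - 4)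

variable {M}

/-- Coordinates of the sites of the open-corridor pairs of `(Q)`. [folklore] -/
theorem qPairsP_sites (hM : 64 ≤ M) {e : Sym2 (Site 2)} (he : e ∈ qPairsP M) {x : Site 2} (hx : x ∈ e) :
    ((M : ℤ) + 1 ≤ x 0 ∧ x 0 + 1 ≤ 8 * M ∧ |x 1| ≤ 2 * (M : ℤ) + (M / 8 : ℕ)) ∨
      (x 0 + 1 ≤ -(M : ℤ) ∧ -(8 * (M : ℤ)) + 1 ≤ x 0 ∧ 0 ≤ x 1 ∧ x 1 ≤ (M / 64 : ℕ)) := by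
  simp only [qPairsP, Finset.mem_union] at he
  rcases he with ((he | he) | he) | (((he | he) | he) | he) <;>
    have h := apply_le_of_mem_rectanglePairs he hx <;>
    simp only [Matrix.cons_val_zero, Matrix.cons_val_one] at h
  · left; exact ⟨by omega, by omega, abs_le.2 ⟨by omega, by omega⟩⟩
  · left; exact ⟨by omega, by omega, abs_le.2 ⟨by omega, by omega⟩⟩
  · left; exact ⟨by omega, by omega, abs_le.2 ⟨by omega, by omega⟩⟩
  · left; exact ⟨by omega, by omega, abs_le.2 ⟨by omega, by omega⟩⟩
  · left; exact ⟨by omega, by omega, abs_le.2 ⟨by omega, by omega⟩⟩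
  · left; exact ⟨by omega, by omega, abs_le.2 ⟨by omega, by omega⟩⟩
  · right; exact ⟨by omega, by omega, by omega, by omega⟩

/-- Coordinates of the sites of the dual-corridor pairs of `(Q)`. [folklore] -/
theorem qPairsM_sites (hM : 64 ≤ M) {e : Sym2 (Site 2)} (he : e ∈ qPairsM M) {x : Site 2} (hx : x ∈ e) :
    0 ≤ x 0 ∧ x 0 ≤ (M / 64 : ℕ) + 1 ∧ (M : ℤ) + 1 ≤ |x 1| ∧ |x 1| + 1 ≤ 8 * M := by
  simp only [qPairsM, Finset.mem_union] at he
  rcases he with he | he <;>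
    have h := apply_le_of_mem_dualFaceCrossingPairs he hx <;>
    simp only [Matrix.cons_val_zero, Matrix.cons_val_one] at h
  · exact ⟨by omega, by omega, by rw [abs_of_nonneg (by omega)]; omega, by rw [abs_of_nonneg (by omega)]; omega⟩
  · exact ⟨by omega, by omega, by rw [abs_of_nonpos (by omega)]; omega, by rw [abs_of_nonpos (by omega)]; omega⟩

end QEvents

/-! ### Geometry of the pair sets of `(Q)` -/

section QGeometry

open scoped Classical

variable (m₁ M n : ℕ)

/-- The eight zones of the two separated events of `(Q)`. [folklore] -/
def qZones : Set (Site 2) :=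
  (zdSepZoneR m₁ M ∪ zdSepZoneL m₁ M ∪ (zdSepZoneT m₁ M ∪ zdSepZoneB m₁ M)) ∪
    (zdSepZoneR (8 * M) n ∪ zdSepZoneL (8 * M) n ∪ (zdSepZoneT (8 * M) n ∪ zdSepZoneB (8 * M) n))

/-- The zone sites of `(Q)`, as a finite set. [folklore] -/
def qZoneSites : Finset (Site 2) := (box 2 (n + n / 8 + 1)).filter fun v => v ∈ qZones m₁ M n

/-- **The common pairs of `(Q)`**: zone pairs that are not corridor pairs. [folklore] -/
def qPairsS : Finset (Sym2 (Site 2)) := (qZoneSites m₁ M n).sym2 \ (qPairsP M ∪ qPairsM M)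

/-- The pairs determining the inner separated event. [folklore] -/
def qPairsInner : Finset (Sym2 (Site 2)) :=
  ((box 2 (M + M / 8 + 1)).filter fun v =>
    v ∈ zdSepZoneR m₁ M ∪ zdSepZoneL m₁ M ∪ (zdSepZoneT m₁ M ∪ zdSepZoneB m₁ M)).sym2

/-- The pairs determining the outer separated event. [folklore] -/
def qPairsOuter : Finset (Sym2 (Site 2)) :=
  ((box 2 (n + n / 8 + 1)).filter fun v =>
    v ∈ zdSepZoneR (8 * M) n ∪ zdSepZoneL (8 * M) n ∪ (zdSepZoneT (8 * M) n ∪ zdSepZoneB (8 * M) n)).sym2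

variable {m₁ M n}

/-- A zone site is a `qZoneSites` site. [folklore] -/
theorem mem_qZoneSites (hm₁ : 128 ≤ m₁) (hM : 2 * m₁ ≤ M) (hn : 16 * M ≤ n) {x : Site 2}
    (hx : x ∈ qZones m₁ M n) : x ∈ qZoneSites m₁ M n := by
  rw [qZoneSites, Finset.mem_filter, mem_box, Fin.forall_fin_two]
  refine ⟨?_, hx⟩
  rcases hx with hx | hx
  · obtain ⟨⟨h0, h1⟩, -⟩ := zone_sites hm₁ hM hx
    have e0 := abs_le.1 h0; have e1 := abs_le.1 h1
    push_cast
    exact ⟨⟨by omega, by omega⟩, ⟨by omega, by omega⟩⟩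
  · obtain ⟨⟨h0, h1⟩, -⟩ := zone_sites (k := 8 * M) (N := n) (by omega) (by omega) hx
    have e0 := abs_le.1 h0; have e1 := abs_le.1 h1
    push_cast
    exact ⟨⟨by omega, by omega⟩, ⟨by omega, by omega⟩⟩

/-- **(G1)** for `(Q)`: no site of a dual-corridor pair lies in a right or left zone. [folklore] -/
theorem qPairsM_sites_notMem (hm₁ : 128 ≤ m₁) (hM : 2 * m₁ ≤ M) (hn : 16 * M ≤ n)
    {e : Sym2 (Site 2)} (he : e ∈ qPairsM M) {x : Site 2} (hx : x ∈ e) :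
    x ∉ zdSepZoneR m₁ M ∪ zdSepZoneL m₁ M ∧ x ∉ zdSepZoneR (8 * M) n ∪ zdSepZoneL (8 * M) n := by
  have h := qPairsM_sites (by omega) he hx
  have habs0 : |x 0| = x 0 := abs_of_nonneg h.1
  constructor
  · intro hz
    obtain ⟨-, -, hR, -⟩ := zone_sites hm₁ hM (Or.inl hz)
    rcases hR hz with ⟨h1, h2, h3⟩ | ⟨h1, h2⟩ <;> omega
  · intro hz
    obtain ⟨-, -, hR, -⟩ := zone_sites (k := 8 * M) (N := n) (by omega) (by omega) (Or.inl hz)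
    rcases hR hz with ⟨h1, h2, h3⟩ | ⟨h1, h2⟩ <;> omega

/-- **(G2)** for `(Q)`: no site of an open-corridor pair lies in a top or bottom zone. [folklore] -/
theorem qPairsP_sites_notMem (hm₁ : 128 ≤ m₁) (hM : 2 * m₁ ≤ M) (hn : 16 * M ≤ n)
    {e : Sym2 (Site 2)} (he : e ∈ qPairsP M) {x : Site 2} (hx : x ∈ e) :
    x ∉ zdSepZoneT m₁ M ∪ zdSepZoneB m₁ M ∧ x ∉ zdSepZoneT (8 * M) n ∪ zdSepZoneB (8 * M) n := by
  have h := qPairsP_sites (by omega) he hx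
  constructor
  · intro hz
    obtain ⟨-, -, -, hT⟩ := zone_sites hm₁ hM (Or.inr hz)
    rcases hT hz with ⟨h1, h2, h3⟩ | ⟨h1, h2⟩
    · rcases h with ⟨h4, h5, h6⟩ | ⟨h4, h5, h6, h7⟩
      · have := le_abs_self (x 0); omega
      · have := neg_abs_le (x 0); omega
    · rcases h with ⟨h4, h5, h6⟩ | ⟨h4, h5, h6, h7⟩
      · have := le_abs_self (x 0); omega
      · have := neg_abs_le (x 0); omega
  · intro hz
    obtain ⟨-, -, -, hT⟩ := zone_sites (k := 8 * M) (N := n) (by omega) (by omega) (Or.inr hz)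
    rcases hT hz with ⟨h1, h2, h3⟩ | ⟨h1, h2⟩
    · rcases h with ⟨h4, h5, h6⟩ | ⟨h4, h5, h6, h7⟩
      · rcases h1 with h1 | h1
        · rw [abs_le] at h2; rw [le_abs] at h1; omega
        · have := abs_le.1 h6; rw [le_abs] at h1; omega
      · rcases h1 with h1 | h1
        · rw [le_abs] at h1; omega
        · rw [le_abs] at h1; omega
    · rcases h with ⟨h4, h5, h6⟩ | ⟨h4, h5, h6, h7⟩
      · have := abs_le.1 h6; rw [le_abs] at h2; omega
      · rw [le_abs] at h2; omega

/-- **(G3)** for `(Q)`: open-corridor and dual-corridor pairs are disjoint. [folklore] -/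
theorem disjoint_qPairsP_qPairsM (hM : 64 ≤ M) : Disjoint (qPairsP M) (qPairsM M) := by
  rw [Finset.disjoint_left]
  intro e heP heM
  obtain ⟨x, hx⟩ : ∃ x, x ∈ e := ⟨e.out.1, Sym2.out_fst_mem e⟩
  have hP := qPairsP_sites hM heP hx
  have hQ := qPairsM_sites hM heM hx
  rcases hP with ⟨h1, -⟩ | ⟨h1, -⟩ <;> omega

/-- The inner and the outer separated events read disjoint pairs. [folklore] -/
theorem disjoint_qPairsInner_qPairsOuter (hm₁ : 128 ≤ m₁) (hM : 2 * m₁ ≤ M) (hn : 16 * M ≤ n) :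
    Disjoint (↑(qPairsInner m₁ M) : Set (Sym2 (Site 2))) ↑(qPairsOuter M n) := by
  rw [Finset.disjoint_coe, Finset.disjoint_left]
  intro e h1 h2
  obtain ⟨x, hx⟩ : ∃ x, x ∈ e := ⟨e.out.1, Sym2.out_fst_mem e⟩
  rw [qPairsInner, Finset.mem_sym2_iff] at h1
  rw [qPairsOuter, Finset.mem_sym2_iff] at h2
  have a1 := (Finset.mem_filter.1 (h1 x hx)).1
  have a2 := (Finset.mem_filter.1 (h2 x hx)).2
  rw [mem_box, Fin.forall_fin_two] at a1
  push_cast at a1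
  obtain ⟨-, h3, -⟩ := zone_sites (k := 8 * M) (N := n) (by omega) (by omega) a2
  rcases h3 with h3 | h3 <;> rw [le_abs] at h3 <;> omega

/-- The separated event is determined by the pairs of its zone sites. [folklore] -/
theorem determinedBy_zdFiveArmSep {k N R : ℕ} (hk : 128 ≤ k) (hN : 2 * k ≤ N) (hR : N + N / 8 + 1 ≤ R) :
    DeterminedBy (zdFiveArmSep k N)
      ↑(((box 2 R).filter fun v => v ∈ zdSepZoneR k N ∪ zdSepZoneL k N ∪ (zdSepZoneT k N ∪ zdSepZoneB k N)).sym2) := by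
  have hsub : ∀ Z : Set (Site 2), Z ⊆ zdSepZoneR k N ∪ zdSepZoneL k N ∪ (zdSepZoneT k N ∪ zdSepZoneB k N) →
      Z.sym2 ⊆ ↑(((box 2 R).filter fun v => v ∈ zdSepZoneR k N ∪ zdSepZoneL k N ∪ (zdSepZoneT k N ∪ zdSepZoneB k N)).sym2) := by
    intro Z hZ e he
    rw [Finset.mem_coe, Finset.mem_sym2_iff]
    intro x hx
    have hxZ := hZ (Set.mem_sym2_iff_subset.1 he hx)
    rw [Finset.mem_filter, mem_box, Fin.forall_fin_two]
    obtain ⟨⟨h0, h1⟩, -⟩ := zone_sites hk hN hxZ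
    have e0 := abs_le.1 h0; have e1 := abs_le.1 h1
    exact ⟨⟨⟨by omega, by omega⟩, ⟨by omega, by omega⟩⟩, hxZ⟩
  exact ((determinedBy_zdSepOpenPairR (hsub _ fun x hx => Or.inl (Or.inl hx))).inter
    (determinedBy_zdSepOpenArmL (hsub _ fun x hx => Or.inl (Or.inr hx)))).inter
    ((determinedBy_zdSepDualArmT (hsub _ fun x hx => Or.inr (Or.inl hx))).inter
      (determinedBy_zdSepDualArmB (hsub _ fun x hx => Or.inr (Or.inr hx))))

/-- The separated event is measurable (for `128 ≤ k`, `2k ≤ N`). [folklore] -/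
theorem measurableSet_zdFiveArmSep {k N : ℕ} (hk : 128 ≤ k) (hN : 2 * k ≤ N) : MeasurableSet (zdFiveArmSep k N) :=
  (determinedBy_zdFiveArmSep hk hN le_rfl).measurableSet_of_finset

/-- **Independence of the two separated events of `(Q)`.** [folklore] -/
theorem real_zdFiveArmSep_inter (hm₁ : 128 ≤ m₁) (hM : 2 * m₁ ≤ M) (hn : 16 * M ≤ n) :
    (bondPercolation (zdGraph 2) half).real (zdFiveArmSep m₁ M ∩ zdFiveArmSep (8 * M) n) =
      (bondPercolation (zdGraph 2) half).real (zdFiveArmSep m₁ M) *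
        (bondPercolation (zdGraph 2) half).real (zdFiveArmSep (8 * M) n) :=
  bondPercolation_real_inter_of_disjoint (zdGraph 2) half (disjoint_qPairsInner_qPairsOuter hm₁ hM hn)
    (determinedBy_zdFiveArmSep hm₁ hM le_rfl) (determinedBy_zdFiveArmSep (by omega) (by omega) le_rfl)
    (measurableSet_zdFiveArmSep hm₁ hM) (measurableSet_zdFiveArmSep (by omega) (by omega))

end QGeometry

/-! ### The probability of the glued event of `(Q)` -/

section QProbability

open scoped Classical

variable {m₁ M n : ℕ}

/-- The translated top–bottom crossing event is increasing. [folklore] -/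
theorem isUpperSet_tbCrossingAt' (u : Site 2) (w h : ℕ) : IsUpperSet (tbCrossingAt' u w h) :=
  isUpperSet_openCrossing _ _ _

/-- The translated top–bottom crossing event is measurable. [folklore] -/
theorem measurableSet_tbCrossingAt' (u : Site 2) (w h : ℕ) : MeasurableSet (tbCrossingAt' u w h) :=
  measurableSet_tbCrossingAt u w h

/-- RSW lower bound for a top–bottom corridor crossing of aspect ratio at most `1024`. [cite: BollobasRiordan2006, Ch. 3, Cor. 6] -/
theorem le_real_tbCrossingAt'_of_rsw {c : ℝ} (hc : ∀ l : ℕ, 1 ≤ l → c ≤ crossingProb half (1024 * l - 1) (l - 1))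
    (u : Site 2) {w h : ℕ} (hh : h ≤ 1024 * (w + 1) - 1) :
    c ≤ (bondPercolation (zdGraph 2) half).real (tbCrossingAt' u w h) := by
  rw [tbCrossingAt', bondPercolation_real_tbCrossingAt]
  have h' := hc (w + 1) (by omega)
  rw [Nat.add_sub_cancel] at h'
  exact h'.trans (crossingProb_anti_left half hh w)

/-- The open corridors of `(Q)` are increasing. [folklore] -/
theorem isUpperSet_qCorrOpen : IsUpperSet (qCorrOpen M) :=
  (((isUpperSet_lrCrossingAt _ _ _).inter (isUpperSet_tbCrossingAt' _ _ _)).inter (isUpperSet_lrCrossingAt _ _ _)).inter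
    ((((isUpperSet_lrCrossingAt _ _ _).inter (isUpperSet_tbCrossingAt' _ _ _)).inter (isUpperSet_lrCrossingAt _ _ _)).inter
      (isUpperSet_lrCrossingAt _ _ _))

/-- The dual corridors of `(Q)` are decreasing. [folklore] -/
theorem isLowerSet_qCorrDual : IsLowerSet (qCorrDual M) :=
  (isLowerSet_dualFaceCrossing _ _ _).inter (isLowerSet_dualFaceCrossing _ _ _)

/-- Bookkeeping: intersections are determined by unions. [folklore] -/
theorem DeterminedBy.inter_finsetUnion {A B : Set (BondConfig (Site 2))} {F G : Finset (Sym2 (Site 2))}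
    (hA : DeterminedBy A ↑F) (hB : DeterminedBy B ↑G) : DeterminedBy (A ∩ B) ↑(F ∪ G) := by
  push_cast
  exact (hA.mono Set.subset_union_left).inter (hB.mono Set.subset_union_right)

/-- The open corridors of `(Q)` are determined by `qPairsP`. [folklore] -/
theorem determinedBy_qCorrOpen : DeterminedBy (qCorrOpen M) ↑(qPairsP M) := by
  unfold qCorrOpen qPairsP
  exact (((determinedBy_openCrossing_image _ _ _ _).inter_finsetUnion (determinedBy_openCrossing_image _ _ _ _)).inter_finsetUnion
    (determinedBy_openCrossing_image _ _ _ _)).inter_finsetUnion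
    ((((determinedBy_openCrossing_image _ _ _ _).inter_finsetUnion (determinedBy_openCrossing_image _ _ _ _)).inter_finsetUnion
      (determinedBy_openCrossing_image _ _ _ _)).inter_finsetUnion (determinedBy_openCrossing_image _ _ _ _))

/-- The dual corridors of `(Q)` are determined by `qPairsM`. [folklore] -/
theorem determinedBy_qCorrDual : DeterminedBy (qCorrDual M) ↑(qPairsM M) := by
  unfold qCorrDual qPairsM
  push_cast
  exact ((determinedBy_dualFaceCrossing _ _ _).mono Set.subset_union_left).inter
    ((determinedBy_dualFaceCrossing _ _ _).mono Set.subset_union_right)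

/-- The pairs of the right and left zones of both events are common or open-corridor pairs. [folklore] -/
theorem qZoneRL_sym2_subset (hm₁ : 128 ≤ m₁) (hM : 2 * m₁ ≤ M) (hn : 16 * M ≤ n) :
    (zdSepZoneR m₁ M).sym2 ∪ (zdSepZoneL m₁ M).sym2 ∪ ((zdSepZoneR (8 * M) n).sym2 ∪ (zdSepZoneL (8 * M) n).sym2) ⊆
      (↑(qPairsS m₁ M n) ∪ ↑(qPairsP M) : Set (Sym2 (Site 2))) := by
  intro e he
  have hz : ∀ x ∈ e, x ∈ zdSepZoneR m₁ M ∪ zdSepZoneL m₁ M ∨ x ∈ zdSepZoneR (8 * M) n ∪ zdSepZoneL (8 * M) n := by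
    intro x hx
    rcases he with (he | he) | (he | he)
    · exact Or.inl (Or.inl (Set.mem_sym2_iff_subset.1 he hx))
    · exact Or.inl (Or.inr (Set.mem_sym2_iff_subset.1 he hx))
    · exact Or.inr (Or.inl (Set.mem_sym2_iff_subset.1 he hx))
    · exact Or.inr (Or.inr (Set.mem_sym2_iff_subset.1 he hx))
  by_cases hP : e ∈ qPairsP M
  · exact Or.inr hP
  · left
    rw [Finset.mem_coe, qPairsS, Finset.mem_sdiff, Finset.mem_union, Finset.mem_sym2_iff]
    refine ⟨fun x hx => mem_qZoneSites hm₁ hM hn ?_, ?_⟩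
    · rcases hz x hx with h | h
      · exact Or.inl (Or.inl h)
      · exact Or.inr (Or.inl h)
    · rintro (h | h)
      · exact hP h
      · obtain ⟨x, hx⟩ : ∃ x, x ∈ e := ⟨e.out.1, Sym2.out_fst_mem e⟩
        have := qPairsM_sites_notMem hm₁ hM hn h hx
        rcases hz x hx with h' | h'
        · exact this.1 h'
        · exact this.2 h'

/-- The pairs of the top and bottom zones of both events are common or dual-corridor pairs. [folklore] -/
theorem qZoneTB_sym2_subset (hm₁ : 128 ≤ m₁) (hM : 2 * m₁ ≤ M) (hn : 16 * M ≤ n) :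
    (zdSepZoneT m₁ M).sym2 ∪ (zdSepZoneB m₁ M).sym2 ∪ ((zdSepZoneT (8 * M) n).sym2 ∪ (zdSepZoneB (8 * M) n).sym2) ⊆
      (↑(qPairsS m₁ M n) ∪ ↑(qPairsM M) : Set (Sym2 (Site 2))) := by
  intro e he
  have hz : ∀ x ∈ e, x ∈ zdSepZoneT m₁ M ∪ zdSepZoneB m₁ M ∨ x ∈ zdSepZoneT (8 * M) n ∪ zdSepZoneB (8 * M) n := by
    intro x hx
    rcases he with (he | he) | (he | he)
    · exact Or.inl (Or.inl (Set.mem_sym2_iff_subset.1 he hx))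
    · exact Or.inl (Or.inr (Set.mem_sym2_iff_subset.1 he hx))
    · exact Or.inr (Or.inl (Set.mem_sym2_iff_subset.1 he hx))
    · exact Or.inr (Or.inr (Set.mem_sym2_iff_subset.1 he hx))
  by_cases hQ : e ∈ qPairsM M
  · exact Or.inr hQ
  · left
    rw [Finset.mem_coe, qPairsS, Finset.mem_sdiff, Finset.mem_union, Finset.mem_sym2_iff]
    refine ⟨fun x hx => mem_qZoneSites hm₁ hM hn ?_, ?_⟩
    · rcases hz x hx with h | h
      · exact Or.inl (Or.inr h)
      · exact Or.inr (Or.inr h)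
    · rintro (h | h)
      · obtain ⟨x, hx⟩ : ∃ x, x ∈ e := ⟨e.out.1, Sym2.out_fst_mem e⟩
        have := qPairsP_sites_notMem hm₁ hM hn h hx
        rcases hz x hx with h' | h'
        · exact this.1 h'
        · exact this.2 h'
      · exact hQ h

variable (m₁ M n)

/-- **The glued event of `(Q)`**: the two separated events and the nine corridors. [cite: Nolin2008, §4.3, Prop. 12 (ii)] -/
def qGlued : Set (BondConfig (Site 2)) :=
  zdFiveArmSep m₁ M ∩ zdFiveArmSep (8 * M) n ∩ (qCorrOpen M ∩ qCorrDual M)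

variable {m₁ M n}

/-- **The probability of the glued event of `(Q)`**: by generalised FKG, RSW in the nine corridors
and the independence of the two separated events,
`c⁹ · P(zdFiveArmSep m₁ M) · P(zdFiveArmSep (8M) n) ≤ P(qGlued m₁ M n)`. [cite: Nolin2008, §4.3, Prop. 12 (ii) and Lemma 13] -/
theorem real_qGlued_ge (hm₁ : 128 ≤ m₁) (hM : 2 * m₁ ≤ M) (hn : 16 * M ≤ n)
    {c : ℝ} (hc0 : 0 < c) (hc : ∀ l : ℕ, 1 ≤ l → c ≤ crossingProb half (1024 * l - 1) (l - 1)) :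
    c ^ 9 * ((bondPercolation (zdGraph 2) half).real (zdFiveArmSep m₁ M) *
        (bondPercolation (zdGraph 2) half).real (zdFiveArmSep (8 * M) n)) ≤
      (bondPercolation (zdGraph 2) half).real (qGlued m₁ M n) := by
  set μ := bondPercolation (zdGraph 2) half with hμ
  have hM64 : 64 ≤ M := by omega
  have hSP : Disjoint (qPairsS m₁ M n) (qPairsP M) := disjoint_sdiff_self_left.mono_right le_sup_left
  have hSM : Disjoint (qPairsS m₁ M n) (qPairsM M) := disjoint_sdiff_self_left.mono_right le_sup_right
  have hPM := disjoint_qPairsP_qPairsM hM64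
  have hRL := qZoneRL_sym2_subset hm₁ hM hn
  have hTB := qZoneTB_sym2_subset hm₁ hM hn
  set Ap := (zdSepOpenPairR m₁ M ∩ zdSepOpenArmL m₁ M) ∩ (zdSepOpenPairR (8 * M) n ∩ zdSepOpenArmL (8 * M) n) with hAp
  set Am := (zdSepDualArmT m₁ M ∩ zdSepDualArmB m₁ M) ∩ (zdSepDualArmT (8 * M) n ∩ zdSepDualArmB (8 * M) n) with hAm
  have dAp : DeterminedBy Ap (↑(qPairsS m₁ M n) ∪ ↑(qPairsP M)) :=
    ((determinedBy_zdSepOpenPairR ((Set.subset_union_left.trans Set.subset_union_left).trans hRL)).inter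
      (determinedBy_zdSepOpenArmL ((Set.subset_union_right.trans Set.subset_union_left).trans hRL))).inter
    ((determinedBy_zdSepOpenPairR ((Set.subset_union_left.trans Set.subset_union_right).trans hRL)).inter
      (determinedBy_zdSepOpenArmL ((Set.subset_union_right.trans Set.subset_union_right).trans hRL)))
  have dAm : DeterminedBy Am (↑(qPairsS m₁ M n) ∪ ↑(qPairsM M)) :=
    ((determinedBy_zdSepDualArmT ((Set.subset_union_left.trans Set.subset_union_left).trans hTB)).inter
      (determinedBy_zdSepDualArmB ((Set.subset_union_right.trans Set.subset_union_left).trans hTB))).inter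
    ((determinedBy_zdSepDualArmT ((Set.subset_union_left.trans Set.subset_union_right).trans hTB)).inter
      (determinedBy_zdSepDualArmB ((Set.subset_union_right.trans Set.subset_union_right).trans hTB)))
  have hFKG := bondPercolation_locallyMonotone_fkg (zdGraph 2) half hSP hSM hPM
    (((isUpperSet_zdSepOpenPairR_inter_zdSepOpenArmL _ _).inter (isUpperSet_zdSepOpenPairR_inter_zdSepOpenArmL _ _)))
    (((isLowerSet_zdSepDualArmT_inter_zdSepDualArmB _ _).inter (isLowerSet_zdSepDualArmT_inter_zdSepDualArmB _ _)))
    (isUpperSet_qCorrOpen (M := M)) (isLowerSet_qCorrDual (M := M)) dAp dAm determinedBy_qCorrOpen determinedBy_qCorrDual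
  -- corridor bounds
  have hc0' := hc0.le
  have hBp : c ^ 7 ≤ μ.real (qCorrOpen M) := by
    have e7 : c ^ 7 = c * c * c * (c * c * c * c) := by ring
    rw [e7]
    unfold qCorrOpen
    refine le_real_inter_of_upper (by positivity) (by positivity)
      (((isUpperSet_lrCrossingAt _ _ _).inter (isUpperSet_tbCrossingAt' _ _ _)).inter (isUpperSet_lrCrossingAt _ _ _))
      ((((isUpperSet_lrCrossingAt _ _ _).inter (isUpperSet_tbCrossingAt' _ _ _)).inter (isUpperSet_lrCrossingAt _ _ _)).inter
        (isUpperSet_lrCrossingAt _ _ _))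
      (((measurableSet_lrCrossingAt _ _ _).inter (measurableSet_tbCrossingAt' _ _ _)).inter (measurableSet_lrCrossingAt _ _ _))
      ((((measurableSet_lrCrossingAt _ _ _).inter (measurableSet_tbCrossingAt' _ _ _)).inter (measurableSet_lrCrossingAt _ _ _)).inter
        (measurableSet_lrCrossingAt _ _ _)) ?_ ?_
    · exact le_real_inter_of_upper (by positivity) hc0'
        ((isUpperSet_lrCrossingAt _ _ _).inter (isUpperSet_tbCrossingAt' _ _ _)) (isUpperSet_lrCrossingAt _ _ _)
        ((measurableSet_lrCrossingAt _ _ _).inter (measurableSet_tbCrossingAt' _ _ _)) (measurableSet_lrCrossingAt _ _ _)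
        (le_real_inter_of_upper hc0' hc0' (isUpperSet_lrCrossingAt _ _ _) (isUpperSet_tbCrossingAt' _ _ _)
          (measurableSet_lrCrossingAt _ _ _) (measurableSet_tbCrossingAt' _ _ _)
          (le_real_lrCrossingAt_of_rsw hc _ (by omega)) (le_real_tbCrossingAt'_of_rsw hc _ (by omega)))
        (le_real_lrCrossingAt_of_rsw hc _ (by omega))
    · refine le_real_inter_of_upper (by positivity) hc0'
        (((isUpperSet_lrCrossingAt _ _ _).inter (isUpperSet_tbCrossingAt' _ _ _)).inter (isUpperSet_lrCrossingAt _ _ _))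
        (isUpperSet_lrCrossingAt _ _ _)
        (((measurableSet_lrCrossingAt _ _ _).inter (measurableSet_tbCrossingAt' _ _ _)).inter (measurableSet_lrCrossingAt _ _ _))
        (measurableSet_lrCrossingAt _ _ _) ?_ (le_real_lrCrossingAt_of_rsw hc _ (by omega))
      exact le_real_inter_of_upper (by positivity) hc0'
        ((isUpperSet_lrCrossingAt _ _ _).inter (isUpperSet_tbCrossingAt' _ _ _)) (isUpperSet_lrCrossingAt _ _ _)
        ((measurableSet_lrCrossingAt _ _ _).inter (measurableSet_tbCrossingAt' _ _ _)) (measurableSet_lrCrossingAt _ _ _)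
        (le_real_inter_of_upper hc0' hc0' (isUpperSet_lrCrossingAt _ _ _) (isUpperSet_tbCrossingAt' _ _ _)
          (measurableSet_lrCrossingAt _ _ _) (measurableSet_tbCrossingAt' _ _ _)
          (le_real_lrCrossingAt_of_rsw hc _ (by omega)) (le_real_tbCrossingAt'_of_rsw hc _ (by omega)))
        (le_real_lrCrossingAt_of_rsw hc _ (by omega))
  have hBm : c ^ 2 ≤ μ.real (qCorrDual M) := by
    rw [pow_two]
    exact le_real_inter_of_lower hc0' hc0' (isLowerSet_dualFaceCrossing _ _ _) (isLowerSet_dualFaceCrossing _ _ _)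
      (measurableSet_dualFaceCrossing _ _ _) (measurableSet_dualFaceCrossing _ _ _)
      (le_real_dualFaceCrossing_of_rsw hc _ (by omega)) (le_real_dualFaceCrossing_of_rsw hc _ (by omega))
  -- assembly
  have hsep : zdFiveArmSep m₁ M ∩ zdFiveArmSep (8 * M) n = Ap ∩ Am := by
    rw [hAp, hAm, zdFiveArmSep, zdFiveArmSep,
      Set.inter_inter_inter_comm (zdSepOpenPairR m₁ M ∩ zdSepOpenArmL m₁ M) (zdSepDualArmT m₁ M ∩ zdSepDualArmB m₁ M)]
  have hset : qGlued m₁ M n = Ap ∩ Am ∩ (qCorrOpen M ∩ qCorrDual M) := by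
    rw [qGlued, hsep]
  rw [hset, ← real_zdFiveArmSep_inter hm₁ hM hn, hsep]
  calc c ^ 9 * μ.real (Ap ∩ Am) = μ.real (Ap ∩ Am) * (c ^ 7 * c ^ 2) := by ring
    _ ≤ μ.real (Ap ∩ Am) * (μ.real (qCorrOpen M) * μ.real (qCorrDual M)) :=
        mul_le_mul_of_nonneg_left (mul_le_mul hBp hBm (by positivity) measureReal_nonneg) measureReal_nonneg
    _ ≤ _ := hFKG

end QProbability

/-! ### The glued event of `(Q)`: the three open arms -/

section QOpenArms

/-- **Composition of a glued arm of `(Q)`**: outer gluing walk of the inner event, corridor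
segment between the two meeting points, inner gluing walk of the outer event (reversed), body of
the outer event. [folklore] -/
theorem exists_composedArmQ {ω : BondConfig (Site 2)} {x mo mi s y x' z' : Site 2}
    (Uo : (zdGraph 2).Walk x mo) (T : (zdGraph 2).Walk s y) (hmo : mo ∈ T.support) (hmi : mi ∈ T.support)
    (Ui : (zdGraph 2).Walk x' mi) (W : (zdGraph 2).Walk x' z')
    (h1 : ∀ e ∈ Uo.edges, e ∈ ω) (h2 : ∀ e ∈ T.edges, e ∈ ω) (h3 : ∀ e ∈ Ui.edges, e ∈ ω) (h4 : ∀ e ∈ W.edges, e ∈ ω) :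
    ∃ P : (zdGraph 2).Walk x z', (∀ e ∈ P.edges, e ∈ ω) ∧
      ∀ z ∈ P.support, z ∈ Uo.support ∨ z ∈ T.support ∨ z ∈ Ui.support ∨ z ∈ W.support := by
  obtain ⟨Ts, hTss, hTse⟩ := exists_walk_within_support T hmo hmi
  refine ⟨Uo.append (Ts.append (Ui.reverse.append W)), fun e he => ?_, fun z hz => ?_⟩
  · simp only [Walk.edges_append, List.mem_append, Walk.edges_reverse, List.mem_reverse] at he
    rcases he with he | he | he | he
    · exact h1 e he
    · exact h2 e (hTse e he)
    · exact h3 e he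
    · exact h4 e he
  · simp only [Walk.mem_support_append_iff, Walk.support_reverse, List.mem_reverse] at hz
    rcases hz with hz | hz | hz | hz
    · exact Or.inl hz
    · exact Or.inr (Or.inl (hTss z hz))
    · exact Or.inr (Or.inr (Or.inl hz))
    · exact Or.inr (Or.inr (Or.inr hz))

variable {m₁ M n : ℕ}

/-- Pieces of a fenced right arm used by the outer gluing lie in the big annulus. [folklore] -/
theorem ZdSepOpenArmR.outer_pieces_mem {ω : BondConfig (Site 2)} {lo hi lo' hi' : ℤ}
    (A : ZdSepOpenArmR ω m₁ M lo hi lo' hi') (hm₁ : 1 ≤ m₁) (hM : 2 * m₁ ≤ M) (hn : 16 * M ≤ n)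
    (hlo' : |lo'| ≤ M / 2) (hhi' : |hi'| ≤ M / 2) {z : Site 2}
    (hz : z ∈ A.W.support ∨ z ∈ A.P.support ∨ z ∈ A.V.support) :
    z ∈ sqAnnulus m₁ n ∧ |z 0| ≤ (M : ℤ) + (M / 8 : ℕ) ∧ |z 1| ≤ (M : ℤ) + (M / 8 : ℕ) := by
  have hz1 := A.hz
  have ha := abs_le.1 hlo'; have hb := abs_le.1 hhi'
  rw [mem_sqAnnulus_iff hm₁, Fin.forall_fin_two, Fin.exists_fin_two]
  rcases hz with hz | hz | hz
  · have h := A.hW z hz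
    rw [mem_sqAnnulus_iff hm₁, Fin.forall_fin_two, Fin.exists_fin_two] at h
    obtain ⟨⟨h0, h1⟩, h2⟩ := h
    exact ⟨⟨⟨by omega, by omega⟩, h2⟩, abs_le.2 ⟨by omega, by omega⟩, abs_le.2 ⟨by omega, by omega⟩⟩
  · obtain ⟨h1, h2⟩ := A.hP z hz
    have e1 := abs_le.1 (show |z 0 - A.z 0| ≤ (M / 8 : ℕ) - 1 by omega)
    have e2 := abs_le.1 (show |z 1 - A.z 1| ≤ (M / 8 : ℕ) - 1 by omega)
    exact ⟨⟨⟨⟨by omega, by omega⟩, ⟨by omega, by omega⟩⟩, Or.inl (Or.inl (by omega))⟩,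
      abs_le.2 ⟨by omega, by omega⟩, abs_le.2 ⟨by omega, by omega⟩⟩
  · obtain ⟨h1, h2, h3⟩ := A.hV z hz
    have e1 := abs_le.1 h3
    exact ⟨⟨⟨⟨by omega, by omega⟩, ⟨by omega, by omega⟩⟩, Or.inl (Or.inl (by omega))⟩,
      abs_le.2 ⟨by omega, by omega⟩, abs_le.2 ⟨by omega, by omega⟩⟩

/-- Pieces of a fenced right arm of the OUTER event used by the inner gluing, and its body, lie in
the big annulus and have a coordinate `≥ 4M + 1`. [folklore] -/
theorem ZdSepOpenArmR.inner_pieces_mem {ω : BondConfig (Site 2)} {lo hi lo' hi' : ℤ}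
    (A : ZdSepOpenArmR ω (8 * M) n lo hi lo' hi') (hm₁ : 1 ≤ m₁) (hM : 2 * m₁ ≤ M) (hn : 16 * M ≤ n)
    (hlo : |lo| ≤ 3 * M) (hhi : |hi| ≤ 3 * M) {z : Site 2}
    (hz : z ∈ A.P'.support ∨ z ∈ A.V'.support ∨ z ∈ A.W.support) :
    z ∈ sqAnnulus m₁ n ∧ (4 * (M : ℤ) + 1 ≤ |z 0| ∨ 4 * (M : ℤ) + 1 ≤ |z 1|) := by
  have hx := A.hx
  have ha := abs_le.1 hlo; have hb := abs_le.1 hhi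
  rw [mem_sqAnnulus_iff hm₁, Fin.forall_fin_two, Fin.exists_fin_two]
  rcases hz with hz | hz | hz
  · obtain ⟨h1, h2⟩ := A.hP' z hz
    have e1 := abs_le.1 (show |z 0 - A.x 0| ≤ ((8 * M) / 8 : ℕ) - 1 by omega)
    have e2 := abs_le.1 (show |z 1 - A.x 1| ≤ ((8 * M) / 8 : ℕ) - 1 by omega)
    exact ⟨⟨⟨⟨by omega, by omega⟩, ⟨by omega, by omega⟩⟩, Or.inl (Or.inl (by omega))⟩, Or.inl (by rw [le_abs]; omega)⟩
  · obtain ⟨h1, h2, h3⟩ := A.hV' z hz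
    have e1 := abs_le.1 h3
    exact ⟨⟨⟨⟨by omega, by omega⟩, ⟨by omega, by omega⟩⟩, Or.inl (Or.inl (by omega))⟩, Or.inl (by rw [le_abs]; omega)⟩
  · have h := A.hW z hz
    rw [mem_sqAnnulus_iff (by omega), Fin.forall_fin_two, Fin.exists_fin_two] at h
    obtain ⟨⟨h0, h1⟩, h2⟩ := h
    refine ⟨⟨⟨h0, h1⟩, ?_⟩, ?_⟩
    · rcases h2 with h2 | h2 <;> [left; right] <;> omega
    · rcases h2 with h2 | h2 <;> [left; right] <;> rw [le_abs] <;> omega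

/-- The same for fenced left arms. [folklore] -/
theorem ZdSepOpenArmL.outer_pieces_mem {ω : BondConfig (Site 2)} {lo hi lo' hi' : ℤ}
    (A : ZdSepOpenArmL ω m₁ M lo hi lo' hi') (hm₁ : 1 ≤ m₁) (hM : 2 * m₁ ≤ M) (hn : 16 * M ≤ n)
    (hlo' : |lo'| ≤ M / 2) (hhi' : |hi'| ≤ M / 2) {z : Site 2}
    (hz : z ∈ A.W.support ∨ z ∈ A.P.support ∨ z ∈ A.V.support) : z ∈ sqAnnulus m₁ n := by
  have hz1 := A.hz
  have ha := abs_le.1 hlo'; have hb := abs_le.1 hhi'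
  rw [mem_sqAnnulus_iff hm₁, Fin.forall_fin_two, Fin.exists_fin_two]
  rcases hz with hz | hz | hz
  · have h := A.hW z hz
    rw [mem_sqAnnulus_iff hm₁, Fin.forall_fin_two, Fin.exists_fin_two] at h
    obtain ⟨⟨h0, h1⟩, h2⟩ := h
    exact ⟨⟨by omega, by omega⟩, h2⟩
  · obtain ⟨h1, h2⟩ := A.hP z hz
    have e1 := abs_le.1 (show |z 0 - A.z 0| ≤ (M / 8 : ℕ) - 1 by omega)
    have e2 := abs_le.1 (show |z 1 - A.z 1| ≤ (M / 8 : ℕ) - 1 by omega)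
    exact ⟨⟨⟨by omega, by omega⟩, ⟨by omega, by omega⟩⟩, Or.inl (Or.inr (by omega))⟩
  · obtain ⟨h1, h2, h3⟩ := A.hV z hz
    have e1 := abs_le.1 h3
    exact ⟨⟨⟨by omega, by omega⟩, ⟨by omega, by omega⟩⟩, Or.inl (Or.inr (by omega))⟩

/-- The same for fenced left arms of the outer event. [folklore] -/
theorem ZdSepOpenArmL.inner_pieces_mem {ω : BondConfig (Site 2)} {lo hi lo' hi' : ℤ}
    (A : ZdSepOpenArmL ω (8 * M) n lo hi lo' hi') (hm₁ : 1 ≤ m₁) (hM : 2 * m₁ ≤ M) (hn : 16 * M ≤ n)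
    (hlo : |lo| ≤ 3 * M) (hhi : |hi| ≤ 3 * M) {z : Site 2}
    (hz : z ∈ A.P'.support ∨ z ∈ A.V'.support ∨ z ∈ A.W.support) : z ∈ sqAnnulus m₁ n := by
  have hx := A.hx
  have ha := abs_le.1 hlo; have hb := abs_le.1 hhi
  rw [mem_sqAnnulus_iff hm₁, Fin.forall_fin_two, Fin.exists_fin_two]
  rcases hz with hz | hz | hz
  · obtain ⟨h1, h2⟩ := A.hP' z hz
    have e1 := abs_le.1 (show |z 0 - A.x 0| ≤ ((8 * M) / 8 : ℕ) - 1 by omega)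
    have e2 := abs_le.1 (show |z 1 - A.x 1| ≤ ((8 * M) / 8 : ℕ) - 1 by omega)
    exact ⟨⟨⟨by omega, by omega⟩, ⟨by omega, by omega⟩⟩, Or.inl (Or.inr (by omega))⟩
  · obtain ⟨h1, h2, h3⟩ := A.hV' z hz
    have e1 := abs_le.1 h3
    exact ⟨⟨⟨by omega, by omega⟩, ⟨by omega, by omega⟩⟩, Or.inl (Or.inr (by omega))⟩
  · have h := A.hW z hz
    rw [mem_sqAnnulus_iff (by omega), Fin.forall_fin_two, Fin.exists_fin_two] at h
    obtain ⟨⟨h0, h1⟩, h2⟩ := h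
    refine ⟨⟨h0, h1⟩, ?_⟩
    rcases h2 with h2 | h2 <;> [left; right] <;> omega

set_option maxHeartbeats 1600000 in
/-- **The glued upper right arm of `(Q)`.** [cite: Nolin2008, §4.3, Prop. 12 (ii)] -/
theorem qArm_Rpos (hm₁ : 128 ≤ m₁) (hM : 2 * m₁ ≤ M) (hn : 16 * M ≤ n) {ω : BondConfig (Site 2)}
    (hωE : ω ⊆ (zdGraph 2).edgeSet)
    (A₁ : ZdSepOpenArmR ω m₁ M (m₁ / 4 : ℕ) ((m₁ / 4 : ℕ) + (m₁ / 64 : ℕ)) (M / 4 : ℕ) ((M / 4 : ℕ) + (M / 64 : ℕ)))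
    (A₂ : ZdSepOpenArmR ω (8 * M) n ((8 * M) / 4 : ℕ) (((8 * M) / 4 : ℕ) + ((8 * M) / 64 : ℕ)) (n / 4 : ℕ) ((n / 4 : ℕ) + (n / 64 : ℕ)))
    (hR1 : ω ∈ lrCrossingAt ![(M : ℤ) + 1, (M / 4 : ℕ)] (3 * M + M / 8 - 1) (M / 64))
    (hR2 : ω ∈ tbCrossingAt' ![4 * (M : ℤ), (M / 4 : ℕ)] (M / 8) (2 * M + M / 8 - M / 4))
    (hR3 : ω ∈ lrCrossingAt ![4 * (M : ℤ), 2 * (M : ℤ)] (4 * M - 1) (M / 8)) :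
    ∃ W : (zdGraph 2).Walk A₁.x A₂.z, (∀ e ∈ W.edges, e ∈ ω) ∧ (∀ z ∈ W.support, z ∈ sqAnnulus m₁ n) ∧
      ∀ z ∈ W.support, z ∈ A₁.carrier ∨ (0 < z 1 ∧ (M : ℤ) + 1 ≤ z 0 ∧ z 0 + 1 ≤ 8 * M ∧ z 1 ≤ 3 * M) ∨ z ∈ A₂.carrier := by
  have hm1 : 1 ≤ m₁ := by omega
  have hE : 1 ≤ M / 8 := by omega
  have he8 : 1 ≤ (8 * M) / 8 := by omega
  have e4 : (((8 * M) / 4 : ℕ) : ℤ) = 2 * M := by omega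
  have e8 : (((8 * M) / 8 : ℕ) : ℤ) = M := by omega
  have e64 : (((8 * M) / 64 : ℕ) : ℤ) = (M / 8 : ℕ) := by omega
  obtain ⟨s₁, y₁, T₁, hs₁, hy₁, hT₁s, hT₁e⟩ := exists_walk_of_mem_lrCrossingAt hωE hR1
  obtain ⟨s₂, y₂, T₂, hs₂, hy₂, hT₂s, hT₂e⟩ := exists_walk_of_mem_tbCrossingAt hωE hR2
  obtain ⟨s₃, y₃, T₃, hs₃, hy₃, hT₃s, hT₃e⟩ := exists_walk_of_mem_lrCrossingAt hωE hR3
  simp only [Matrix.cons_val_zero, Matrix.cons_val_one] at hs₁ hy₁ hT₁s hs₂ hy₂ hT₂s hs₃ hy₃ hT₃s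
  have c1 : ((3 * M + M / 8 - 1 : ℕ) : ℤ) = 3 * M + (M / 8 : ℕ) - 1 := by omega
  have c2 : ((2 * M + M / 8 - M / 4 : ℕ) : ℤ) = 2 * M + (M / 8 : ℕ) - (M / 4 : ℕ) := by omega
  have c3 : ((4 * M - 1 : ℕ) : ℤ) = 4 * M - 1 := by omega
  rw [c1] at hy₁ hT₁s; rw [c2] at hy₂ hT₂s; rw [c3] at hy₃ hT₃s
  obtain ⟨T, hTe, hTs⟩ := exists_chain3 (a := (M : ℤ) + 1) (X₁ := 4 * (M : ℤ)) (X₂ := 4 * (M : ℤ) + (M / 8 : ℕ))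
    (b := 8 * (M : ℤ) - 1) (Y₀ := ((M / 4 : ℕ) : ℤ)) (Y₁ := 2 * (M : ℤ) + (M / 8 : ℕ)) (I₁lo := ((M / 4 : ℕ) : ℤ))
    (I₁hi := ((M / 4 : ℕ) : ℤ) + (M / 64 : ℕ)) (I₃lo := 2 * (M : ℤ)) (I₃hi := 2 * (M : ℤ) + (M / 8 : ℕ))
    (by omega) (by omega) (by omega) ⟨by omega, by omega, by omega⟩ ⟨by omega, by omega, by omega⟩
    T₁ hs₁ (by rw [hy₁]; ring) (fun z hz => by have := hT₁s z hz; exact ⟨this.1, by omega, this.2.2.1, this.2.2.2⟩) hT₁e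
    T₂ hs₂ (by rw [hy₂]; omega) (fun z hz => by have := hT₂s z hz; exact ⟨this.1, by omega, this.2.2.1, by omega⟩) hT₂e
    T₃ hs₃ (by rw [hy₃]; ring) (fun z hz => by have := hT₃s z hz; exact ⟨this.1, by omega, this.2.2.1, this.2.2.2⟩) hT₃e
  have hTbox : ∀ z ∈ T.support, (M : ℤ) + 1 ≤ z 0 ∧ z 0 + 1 ≤ 8 * M ∧ 0 < z 1 ∧ z 1 ≤ 3 * M := by
    intro z hz
    rcases hTs z hz with h | h | h
    · have := hT₁s z h; exact ⟨this.1, by omega, by omega, by omega⟩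
    · have := hT₂s z h; exact ⟨by omega, by omega, by omega, by omega⟩
    · have := hT₃s z h; exact ⟨by omega, by omega, by omega, by omega⟩
  have hTo : ∀ z ∈ T.support, (M : ℤ) + 1 ≤ z 0 ∧ (z 0 ≤ (M : ℤ) + (M / 8 : ℕ) → ((M / 4 : ℕ) : ℤ) ≤ z 1 ∧ z 1 ≤ ((M / 4 : ℕ) : ℤ) + (M / 64 : ℕ)) := by
    intro z hz
    rcases hTs z hz with h | h | h
    · have := hT₁s z h; exact ⟨this.1, fun _ => ⟨this.2.2.1, this.2.2.2⟩⟩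
    · have := hT₂s z h; exact ⟨by omega, fun h' => by omega⟩
    · have := hT₃s z h; exact ⟨by omega, fun h' => by omega⟩
  have hTi : ∀ z ∈ T.support, z 0 + 1 ≤ ((8 * M : ℕ) : ℤ) ∧ (((8 * M : ℕ) : ℤ) - ((8 * M) / 8 : ℕ) ≤ z 0 →
      (((8 * M) / 4 : ℕ) : ℤ) ≤ z 1 ∧ z 1 ≤ (((8 * M) / 4 : ℕ) : ℤ) + ((8 * M) / 64 : ℕ)) := by
    intro z hz
    rw [e4, e8, e64]; push_cast
    rcases hTs z hz with h | h | h
    · have := hT₁s z h; exact ⟨by omega, fun h' => by omega⟩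
    · have := hT₂s z h; exact ⟨by omega, fun h' => by omega⟩
    · have := hT₃s z h; exact ⟨by omega, fun _ => ⟨this.2.2.1, this.2.2.2⟩⟩
  obtain ⟨mo, hmo, Uo, hUos, hUoe⟩ := A₁.exists_walk_of_outerCorridor_fine rfl hE T hs₁ (by rw [hy₃]; omega) hTo
  obtain ⟨mi, hmi, Ui, hUis, hUie⟩ := A₂.exists_walk_of_innerCorridor_fine rfl he8 T (by rw [hy₃]; push_cast; ring)
    (by rw [hs₁, e8]; push_cast; omega) hTi
  obtain ⟨W, hWe, hWs⟩ := exists_composedArmQ Uo T hmo hmi Ui A₂.W hUoe hTe hUie A₂.hWo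
  refine ⟨W, hWe, fun z hz => ?_, fun z hz => ?_⟩
  · rcases hWs z hz with h | h | h | h
    · exact (A₁.outer_pieces_mem hm1 hM hn (abs_le.2 ⟨by omega, by omega⟩) (abs_le.2 ⟨by omega, by omega⟩) (hUos z h)).1
    · have := hTbox z h
      rw [mem_sqAnnulus_iff hm1, Fin.forall_fin_two, Fin.exists_fin_two]
      exact ⟨⟨⟨by omega, by omega⟩, ⟨by omega, by omega⟩⟩, Or.inl (Or.inl (by omega))⟩
    · refine (A₂.inner_pieces_mem hm1 hM hn (abs_le.2 ⟨by omega, by omega⟩) (abs_le.2 ⟨by omega, by omega⟩) ?_).1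
      rcases hUis z h with h | h
      · exact Or.inl h
      · exact Or.inr (Or.inl h)
    · exact (A₂.inner_pieces_mem hm1 hM hn (abs_le.2 ⟨by omega, by omega⟩) (abs_le.2 ⟨by omega, by omega⟩)
        (Or.inr (Or.inr h))).1
  · rcases hWs z hz with h | h | h | h
    · left; rcases hUos z h with h | h | h
      · exact Or.inl h
      · exact Or.inr (Or.inr (Or.inl h))
      · exact Or.inr (Or.inl h)
    · right; left; have := hTbox z h; exact ⟨this.2.2.1, this.1, this.2.1, this.2.2.2⟩
    · right; right; rcases hUis z h with h | h
      · exact Or.inr (Or.inr (Or.inr (Or.inr h)))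
      · exact Or.inr (Or.inr (Or.inr (Or.inl h)))
    · right; right; exact Or.inl h

set_option maxHeartbeats 1600000 in
/-- **The glued lower right arm of `(Q)`.** [cite: Nolin2008, §4.3, Prop. 12 (ii)] -/
theorem qArm_Rneg (hm₁ : 128 ≤ m₁) (hM : 2 * m₁ ≤ M) (hn : 16 * M ≤ n) {ω : BondConfig (Site 2)}
    (hωE : ω ⊆ (zdGraph 2).edgeSet)
    (A₁ : ZdSepOpenArmR ω m₁ M (-((m₁ / 4 : ℕ) + (m₁ / 64 : ℕ) : ℤ)) (-(m₁ / 4 : ℕ)) (-((M / 4 : ℕ) + (M / 64 : ℕ) : ℤ)) (-(M / 4 : ℕ)))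
    (A₂ : ZdSepOpenArmR ω (8 * M) n (-(((8 * M) / 4 : ℕ) + ((8 * M) / 64 : ℕ) : ℤ)) (-((8 * M) / 4 : ℕ))
      (-((n / 4 : ℕ) + (n / 64 : ℕ) : ℤ)) (-(n / 4 : ℕ)))
    (hS1 : ω ∈ lrCrossingAt ![(M : ℤ) + 1, -((M / 4 : ℕ) + (M / 64 : ℕ) : ℤ)] (3 * M + M / 8 - 1) (M / 64))
    (hS2 : ω ∈ tbCrossingAt' ![4 * (M : ℤ), -(2 * (M : ℤ) + (M / 8 : ℕ))] (M / 8) (2 * M + M / 8 - M / 4))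
    (hS3 : ω ∈ lrCrossingAt ![4 * (M : ℤ), -(2 * (M : ℤ) + (M / 8 : ℕ))] (4 * M - 1) (M / 8)) :
    ∃ W : (zdGraph 2).Walk A₁.x A₂.z, (∀ e ∈ W.edges, e ∈ ω) ∧ (∀ z ∈ W.support, z ∈ sqAnnulus m₁ n) ∧
      ∀ z ∈ W.support, z ∈ A₁.carrier ∨ (z 1 < 0 ∧ (M : ℤ) + 1 ≤ z 0 ∧ z 0 + 1 ≤ 8 * M ∧ -(3 * (M : ℤ)) ≤ z 1) ∨ z ∈ A₂.carrier := by
  have hm1 : 1 ≤ m₁ := by omega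
  have hE : 1 ≤ M / 8 := by omega
  have he8 : 1 ≤ (8 * M) / 8 := by omega
  have e4 : (((8 * M) / 4 : ℕ) : ℤ) = 2 * M := by omega
  have e8 : (((8 * M) / 8 : ℕ) : ℤ) = M := by omega
  have e64 : (((8 * M) / 64 : ℕ) : ℤ) = (M / 8 : ℕ) := by omega
  obtain ⟨s₁, y₁, T₁, hs₁, hy₁, hT₁s, hT₁e⟩ := exists_walk_of_mem_lrCrossingAt hωE hS1
  obtain ⟨s₂, y₂, T₂, hs₂, hy₂, hT₂s, hT₂e⟩ := exists_walk_of_mem_tbCrossingAt hωE hS2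
  obtain ⟨s₃, y₃, T₃, hs₃, hy₃, hT₃s, hT₃e⟩ := exists_walk_of_mem_lrCrossingAt hωE hS3
  simp only [Matrix.cons_val_zero, Matrix.cons_val_one] at hs₁ hy₁ hT₁s hs₂ hy₂ hT₂s hs₃ hy₃ hT₃s
  have c1 : ((3 * M + M / 8 - 1 : ℕ) : ℤ) = 3 * M + (M / 8 : ℕ) - 1 := by omega
  have c2 : ((2 * M + M / 8 - M / 4 : ℕ) : ℤ) = 2 * M + (M / 8 : ℕ) - (M / 4 : ℕ) := by omega
  have c3 : ((4 * M - 1 : ℕ) : ℤ) = 4 * M - 1 := by omega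
  rw [c1] at hy₁ hT₁s; rw [c2] at hy₂ hT₂s; rw [c3] at hy₃ hT₃s
  obtain ⟨T, hTe, hTs⟩ := exists_chain3 (a := (M : ℤ) + 1) (X₁ := 4 * (M : ℤ)) (X₂ := 4 * (M : ℤ) + (M / 8 : ℕ))
    (b := 8 * (M : ℤ) - 1) (Y₀ := -(2 * (M : ℤ) + (M / 8 : ℕ))) (Y₁ := -((M / 4 : ℕ) : ℤ))
    (I₁lo := -(((M / 4 : ℕ) : ℤ) + (M / 64 : ℕ))) (I₁hi := -((M / 4 : ℕ) : ℤ))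
    (I₃lo := -(2 * (M : ℤ) + (M / 8 : ℕ))) (I₃hi := -(2 * (M : ℤ)))
    (by omega) (by omega) (by omega) ⟨by omega, by omega, by omega⟩ ⟨by omega, by omega, by omega⟩
    T₁ hs₁ (by rw [hy₁]; ring) (fun z hz => by have := hT₁s z hz; exact ⟨this.1, by omega, by omega, by omega⟩) hT₁e
    T₂ hs₂ (by rw [hy₂]; omega) (fun z hz => by have := hT₂s z hz; exact ⟨this.1, by omega, this.2.2.1, by omega⟩) hT₂e
    T₃ hs₃ (by rw [hy₃]; ring) (fun z hz => by have := hT₃s z hz; exact ⟨this.1, by omega, this.2.2.1, by omega⟩) hT₃e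
  have hTbox : ∀ z ∈ T.support, (M : ℤ) + 1 ≤ z 0 ∧ z 0 + 1 ≤ 8 * M ∧ z 1 < 0 ∧ -(3 * (M : ℤ)) ≤ z 1 := by
    intro z hz
    rcases hTs z hz with h | h | h
    · have := hT₁s z h; exact ⟨this.1, by omega, by omega, by omega⟩
    · have := hT₂s z h; exact ⟨by omega, by omega, by omega, by omega⟩
    · have := hT₃s z h; exact ⟨by omega, by omega, by omega, by omega⟩
  have hTo : ∀ z ∈ T.support, (M : ℤ) + 1 ≤ z 0 ∧ (z 0 ≤ (M : ℤ) + (M / 8 : ℕ) →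
      -((M / 4 : ℕ) + (M / 64 : ℕ) : ℤ) ≤ z 1 ∧ z 1 ≤ -((M / 4 : ℕ) + (M / 64 : ℕ) : ℤ) + (M / 64 : ℕ)) := by
    intro z hz
    rcases hTs z hz with h | h | h
    · have := hT₁s z h; exact ⟨this.1, fun _ => ⟨by omega, by omega⟩⟩
    · have := hT₂s z h; exact ⟨by omega, fun h' => by omega⟩
    · have := hT₃s z h; exact ⟨by omega, fun h' => by omega⟩
  have hTi : ∀ z ∈ T.support, z 0 + 1 ≤ ((8 * M : ℕ) : ℤ) ∧ (((8 * M : ℕ) : ℤ) - ((8 * M) / 8 : ℕ) ≤ z 0 →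
      -(((8 * M) / 4 : ℕ) + ((8 * M) / 64 : ℕ) : ℤ) ≤ z 1 ∧ z 1 ≤ -(((8 * M) / 4 : ℕ) + ((8 * M) / 64 : ℕ) : ℤ) + ((8 * M) / 64 : ℕ)) := by
    intro z hz
    rw [e4, e8, e64]; push_cast
    rcases hTs z hz with h | h | h
    · have := hT₁s z h; exact ⟨by omega, fun h' => by omega⟩
    · have := hT₂s z h; exact ⟨by omega, fun h' => by omega⟩
    · have := hT₃s z h; exact ⟨by omega, fun _ => ⟨by omega, by omega⟩⟩
  obtain ⟨mo, hmo, Uo, hUos, hUoe⟩ := A₁.exists_walk_of_outerCorridor_fine (by push_cast; ring) hE T hs₁ (by rw [hy₃]; omega) hTo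
  obtain ⟨mi, hmi, Ui, hUis, hUie⟩ := A₂.exists_walk_of_innerCorridor_fine (by push_cast; ring) he8 T
    (by rw [hy₃]; push_cast; ring) (by rw [hs₁, e8]; push_cast; omega) hTi
  obtain ⟨W, hWe, hWs⟩ := exists_composedArmQ Uo T hmo hmi Ui A₂.W hUoe hTe hUie A₂.hWo
  refine ⟨W, hWe, fun z hz => ?_, fun z hz => ?_⟩
  · rcases hWs z hz with h | h | h | h
    · exact (A₁.outer_pieces_mem hm1 hM hn (abs_le.2 ⟨by omega, by omega⟩) (abs_le.2 ⟨by omega, by omega⟩) (hUos z h)).1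
    · have := hTbox z h
      rw [mem_sqAnnulus_iff hm1, Fin.forall_fin_two, Fin.exists_fin_two]
      exact ⟨⟨⟨by omega, by omega⟩, ⟨by omega, by omega⟩⟩, Or.inl (Or.inl (by omega))⟩
    · refine (A₂.inner_pieces_mem hm1 hM hn (abs_le.2 ⟨by omega, by omega⟩) (abs_le.2 ⟨by omega, by omega⟩) ?_).1
      rcases hUis z h with h | h
      · exact Or.inl h
      · exact Or.inr (Or.inl h)
    · exact (A₂.inner_pieces_mem hm1 hM hn (abs_le.2 ⟨by omega, by omega⟩) (abs_le.2 ⟨by omega, by omega⟩)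
        (Or.inr (Or.inr h))).1
  · rcases hWs z hz with h | h | h | h
    · left; rcases hUos z h with h | h | h
      · exact Or.inl h
      · exact Or.inr (Or.inr (Or.inl h))
      · exact Or.inr (Or.inl h)
    · right; left; have := hTbox z h; exact ⟨this.2.2.1, this.1, this.2.1, this.2.2.2⟩
    · right; right; rcases hUis z h with h | h
      · exact Or.inr (Or.inr (Or.inr (Or.inr h)))
      · exact Or.inr (Or.inr (Or.inr (Or.inl h)))
    · right; right; exact Or.inl h

/-- **The glued left arm of `(Q)`.** [cite: Nolin2008, §4.3, Prop. 12 (ii)] -/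
theorem qArm_L (hm₁ : 128 ≤ m₁) (hM : 2 * m₁ ≤ M) (hn : 16 * M ≤ n) {ω : BondConfig (Site 2)}
    (hωE : ω ⊆ (zdGraph 2).edgeSet)
    (A₁ : ZdSepOpenArmL ω m₁ M 0 (m₁ / 64 : ℕ) 0 (M / 64 : ℕ)) (A₂ : ZdSepOpenArmL ω (8 * M) n 0 ((8 * M) / 64 : ℕ) 0 (n / 64 : ℕ))
    (hL : ω ∈ lrCrossingAt ![-(8 * (M : ℤ)) + 1, 0] (7 * M - 2) (M / 64)) :
    ∃ W : (zdGraph 2).Walk A₁.x A₂.z, (∀ e ∈ W.edges, e ∈ ω) ∧ (∀ z ∈ W.support, z ∈ sqAnnulus m₁ n) := by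
  have hm1 : 1 ≤ m₁ := by omega
  have hE : 1 ≤ M / 8 := by omega
  have he8 : 1 ≤ (8 * M) / 8 := by omega
  have e8 : (((8 * M) / 8 : ℕ) : ℤ) = M := by omega
  have e64 : (((8 * M) / 64 : ℕ) : ℤ) = (M / 8 : ℕ) := by omega
  obtain ⟨sl, yl, Tl, hsl, hyl, hTls, hTle⟩ := exists_walk_of_mem_lrCrossingAt hωE hL
  simp only [Matrix.cons_val_zero, Matrix.cons_val_one] at hsl hyl hTls
  have c1 : ((7 * M - 2 : ℕ) : ℤ) = 7 * M - 2 := by omega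
  rw [c1] at hyl hTls
  obtain ⟨ml, hml, Ul, hUls, hUle⟩ := A₁.exists_walk_of_outerCorridor_fine (by simp) hE Tl.reverse (by rw [hyl]; ring)
    (by rw [hsl]; omega)
    (fun z hz => by
      rw [Walk.support_reverse, List.mem_reverse] at hz
      have := hTls z hz
      exact ⟨by omega, fun _ => ⟨this.2.2.1, by omega⟩⟩)
  obtain ⟨mj, hmj, Uj, hUjs, hUje⟩ := A₂.exists_walk_of_innerCorridor_fine (by simp) he8 Tl.reverse
    (by rw [hsl]; push_cast; ring) (by rw [hyl, e8]; push_cast; omega)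
    (fun z hz => by
      rw [Walk.support_reverse, List.mem_reverse] at hz
      have := hTls z hz
      rw [e8, e64]; push_cast
      exact ⟨by omega, fun _ => ⟨this.2.2.1, by omega⟩⟩)
  obtain ⟨W, hWe, hWs⟩ := exists_composedArmQ Ul Tl.reverse hml hmj Uj A₂.W hUle
    (fun e he => hTle e (by simpa using he)) hUje A₂.hWo
  refine ⟨W, hWe, fun z hz => ?_⟩
  rcases hWs z hz with h | h | h | h
  · exact A₁.outer_pieces_mem hm1 hM hn (by rw [abs_zero]; positivity) (abs_le.2 ⟨by omega, by omega⟩) (hUls z h)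
  · rw [Walk.support_reverse, List.mem_reverse] at h
    have := hTls z h
    rw [mem_sqAnnulus_iff hm1, Fin.forall_fin_two, Fin.exists_fin_two]
    exact ⟨⟨⟨by omega, by omega⟩, ⟨by omega, by omega⟩⟩, Or.inl (Or.inr (by omega))⟩
  · refine A₂.inner_pieces_mem hm1 hM hn (by rw [abs_zero]; positivity) (abs_le.2 ⟨by omega, by omega⟩) ?_
    rcases hUjs z h with h | h
    · exact Or.inl h
    · exact Or.inr (Or.inl h)
  · exact A₂.inner_pieces_mem hm1 hM hn (by rw [abs_zero]; positivity) (abs_le.2 ⟨by omega, by omega⟩) (Or.inr (Or.inr h))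

set_option maxHeartbeats 1600000 in
/-- **The two glued right arms of `(Q)` are vertex-disjoint.** [folklore] -/
theorem qArms_disjoint (hm₁ : 128 ≤ m₁) (hM : 2 * m₁ ≤ M) (hn : 16 * M ≤ n) {ω : BondConfig (Site 2)}
    (A₁ : ZdSepOpenArmR ω m₁ M (m₁ / 4 : ℕ) ((m₁ / 4 : ℕ) + (m₁ / 64 : ℕ)) (M / 4 : ℕ) ((M / 4 : ℕ) + (M / 64 : ℕ)))
    (B₁ : ZdSepOpenArmR ω m₁ M (-((m₁ / 4 : ℕ) + (m₁ / 64 : ℕ) : ℤ)) (-(m₁ / 4 : ℕ)) (-((M / 4 : ℕ) + (M / 64 : ℕ) : ℤ)) (-(M / 4 : ℕ)))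
    (hd₁ : Disjoint A₁.carrier B₁.carrier)
    (A₂ : ZdSepOpenArmR ω (8 * M) n ((8 * M) / 4 : ℕ) (((8 * M) / 4 : ℕ) + ((8 * M) / 64 : ℕ)) (n / 4 : ℕ) ((n / 4 : ℕ) + (n / 64 : ℕ)))
    (B₂ : ZdSepOpenArmR ω (8 * M) n (-(((8 * M) / 4 : ℕ) + ((8 * M) / 64 : ℕ) : ℤ)) (-((8 * M) / 4 : ℕ))
      (-((n / 4 : ℕ) + (n / 64 : ℕ) : ℤ)) (-(n / 4 : ℕ)))
    (hd₂ : Disjoint A₂.carrier B₂.carrier) {z : Site 2}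
    (h₁ : z ∈ A₁.carrier ∨ (0 < z 1 ∧ (M : ℤ) + 1 ≤ z 0 ∧ z 0 + 1 ≤ 8 * M ∧ z 1 ≤ 3 * M) ∨ z ∈ A₂.carrier)
    (h₃ : z ∈ B₁.carrier ∨ (z 1 < 0 ∧ (M : ℤ) + 1 ≤ z 0 ∧ z 0 + 1 ≤ 8 * M ∧ -(3 * (M : ℤ)) ≤ z 1) ∨ z ∈ B₂.carrier) :
    False := by
  have hm1 : 1 ≤ m₁ := by omega
  have e4 : (((8 * M) / 4 : ℕ) : ℤ) = 2 * M := by omega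
  have e8 : (((8 * M) / 8 : ℕ) : ℤ) = M := by omega
  have annR : ∀ {k N : ℕ}, 1 ≤ k → ∀ v ∈ sqAnnulus k N, |v 0| ≤ N ∧ |v 1| ≤ N ∧ ((k : ℤ) ≤ |v 0| ∨ (k : ℤ) ≤ |v 1|) := by
    intro k N hk v hv
    rw [mem_sqAnnulus_iff hk, Fin.forall_fin_two, Fin.exists_fin_two] at hv
    obtain ⟨⟨h0, h1⟩, h2⟩ := hv
    refine ⟨abs_le.2 ⟨h0.1, h0.2⟩, abs_le.2 ⟨h1.1, h1.2⟩, ?_⟩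
    rcases h2 with h2 | h2 <;> [left; right] <;> rw [le_abs] <;> omega
  have s1p : ∀ v ∈ A₁.carrier, v ∈ sqAnnulus m₁ M ∨ 0 < v 1 := by
    intro v hv; rcases A₁.carrier_cases (by omega) (by omega) hv with h | h | h
    · exact Or.inl h
    · right; omega
    · right; omega
  have s1m : ∀ v ∈ B₁.carrier, v ∈ sqAnnulus m₁ M ∨ v 1 < 0 := by
    intro v hv; rcases B₁.carrier_cases (by omega) (by omega) hv with h | h | h
    · exact Or.inl h
    · right; omega
    · right; omega
  have s2p : ∀ v ∈ A₂.carrier, v ∈ sqAnnulus (8 * M) n ∨ 0 < v 1 := by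
    intro v hv; rcases A₂.carrier_cases (by omega) (by omega) hv with h | h | h
    · exact Or.inl h
    · right; omega
    · right; rw [e4, e8] at h; omega
  have s2m : ∀ v ∈ B₂.carrier, v ∈ sqAnnulus (8 * M) n ∨ v 1 < 0 := by
    intro v hv; rcases B₂.carrier_cases (by omega) (by omega) hv with h | h | h
    · exact Or.inl h
    · right; omega
    · right; rw [e4, e8] at h; omega
  have zone1 : ∀ {lo hi lo' hi' : ℤ} (C : ZdSepOpenArmR ω m₁ M lo hi lo' hi'),
      |lo| ≤ ((m₁ / 4 : ℕ) : ℤ) + (m₁ / 64 : ℕ) → |hi| ≤ ((m₁ / 4 : ℕ) : ℤ) + (m₁ / 64 : ℕ) →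
      |lo'| ≤ ((M / 4 : ℕ) : ℤ) + (M / 64 : ℕ) → |hi'| ≤ ((M / 4 : ℕ) : ℤ) + (M / 64 : ℕ) →
      ∀ v ∈ C.carrier, |v 0| ≤ (M : ℤ) + (M / 8 : ℕ) + 1 ∧ |v 1| ≤ (M : ℤ) + (M / 8 : ℕ) + 1 := by
    intro lo hi lo' hi' C h1 h2 h3 h4 v hv
    have hz : v ∈ zdSepZoneR m₁ M := by
      rcases C.carrier_subset h1 h2 h3 h4 hv with h | h | h
      · exact Or.inl h
      · exact Or.inr (Or.inl h)
      · exact Or.inr (Or.inr h)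
    exact (zone_sites hm₁ hM (Or.inl (Or.inl hz))).1
  have zone2 : ∀ {lo hi lo' hi' : ℤ} (C : ZdSepOpenArmR ω (8 * M) n lo hi lo' hi'),
      |lo| ≤ (((8 * M) / 4 : ℕ) : ℤ) + ((8 * M) / 64 : ℕ) → |hi| ≤ (((8 * M) / 4 : ℕ) : ℤ) + ((8 * M) / 64 : ℕ) →
      |lo'| ≤ ((n / 4 : ℕ) : ℤ) + (n / 64 : ℕ) → |hi'| ≤ ((n / 4 : ℕ) : ℤ) + (n / 64 : ℕ) →
      ∀ v ∈ C.carrier, 4 * (M : ℤ) + 1 ≤ |v 0| ∨ 4 * (M : ℤ) + 1 ≤ |v 1| := by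
    intro lo hi lo' hi' C h1 h2 h3 h4 v hv
    have hz : v ∈ zdSepZoneR (8 * M) n := by
      rcases C.carrier_subset h1 h2 h3 h4 hv with h | h | h
      · exact Or.inl h
      · exact Or.inr (Or.inl h)
      · exact Or.inr (Or.inr h)
    have := (zone_sites (k := 8 * M) (N := n) (by omega) (by omega) (Or.inl (Or.inl hz))).2.1
    push_cast at this
    omega
  have hq : 0 ≤ ((m₁ / 4 : ℕ) : ℤ) + (m₁ / 64 : ℕ) := by positivity
  have hQ : 0 ≤ ((M / 4 : ℕ) : ℤ) + (M / 64 : ℕ) := by positivity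
  have hq8 : 0 ≤ (((8 * M) / 4 : ℕ) : ℤ) + ((8 * M) / 64 : ℕ) := by positivity
  have hQn : 0 ≤ ((n / 4 : ℕ) : ℤ) + (n / 64 : ℕ) := by positivity
  have b1A := zone1 A₁ (abs_le.2 ⟨by omega, by omega⟩) (abs_le.2 ⟨by omega, le_rfl⟩) (abs_le.2 ⟨by omega, by omega⟩) (abs_le.2 ⟨by omega, le_rfl⟩)
  have b1B := zone1 B₁ (abs_le.2 ⟨by omega, by omega⟩) (abs_le.2 ⟨by omega, by omega⟩) (abs_le.2 ⟨by omega, by omega⟩) (abs_le.2 ⟨by omega, by omega⟩)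
  have b2A := zone2 A₂ (abs_le.2 ⟨by omega, by omega⟩) (abs_le.2 ⟨by omega, le_rfl⟩) (abs_le.2 ⟨by omega, by omega⟩) (abs_le.2 ⟨by omega, le_rfl⟩)
  have b2B := zone2 B₂ (abs_le.2 ⟨by omega, by omega⟩) (abs_le.2 ⟨by omega, by omega⟩) (abs_le.2 ⟨by omega, by omega⟩) (abs_le.2 ⟨by omega, by omega⟩)
  rcases h₁ with h1 | h1 | h1 <;> rcases h₃ with h3 | h3 | h3
  · exact Set.disjoint_left.1 hd₁ h1 h3
  · rcases s1p z h1 with h | h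
    · have := (annR hm1 z h).1; rw [abs_le] at this; omega
    · omega
  · have a := b1A z h1; have b := b2B z h3
    rw [abs_le, abs_le] at a; rw [le_abs, le_abs] at b; omega
  · rcases s1m z h3 with h | h
    · have := (annR hm1 z h).1; rw [abs_le] at this; omega
    · omega
  · omega
  · rcases s2m z h3 with h | h
    · have := (annR (k := 8 * M) (by omega) z h).2.2; rw [le_abs, le_abs] at this; push_cast at this; omega
    · omega
  · have a := b1B z h3; have b := b2A z h1
    rw [abs_le, abs_le] at a; rw [le_abs, le_abs] at b; omega
  · rcases s2p z h1 with h | h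
    · have := (annR (k := 8 * M) (by omega) z h).2.2; rw [le_abs, le_abs] at this; push_cast at this; omega
    · omega
  · exact Set.disjoint_left.1 hd₂ h1 h3

end QOpenArms

/-! ### The glued event of `(Q)`: the two dual barriers -/

section QDualArms

variable {m₁ M n : ℕ}

/-- **Composition of a glued dual arm of `(Q)`.** [folklore] -/
theorem exists_composedDualArmQ {ω : BondConfig (Site 2)} {f mo mi a b f' g' : Site 2} {R : Site 2 → Prop}
    (Uo : (zdGraph 2).Walk f mo) (Wd : (zdGraph 2).Walk a b) (hmo : mo ∈ Wd.support) (hmi : mi ∈ Wd.support)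
    (Ui : (zdGraph 2).Walk f' mi) (Q : (zdGraph 2).Walk f' g')
    (h1 : ∀ d ∈ Uo.darts, sepEdge d.fst d.snd ∉ ω ∧ ∀ v ∈ sepEdge d.fst d.snd, R v)
    (h2 : ∀ d ∈ Wd.darts, sepEdge d.fst d.snd ∉ ω ∧ ∀ v ∈ sepEdge d.fst d.snd, R v)
    (h3 : ∀ d ∈ Ui.darts, sepEdge d.fst d.snd ∉ ω ∧ ∀ v ∈ sepEdge d.fst d.snd, R v)
    (h4 : ∀ d ∈ Q.darts, sepEdge d.fst d.snd ∉ ω ∧ ∀ v ∈ sepEdge d.fst d.snd, R v) :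
    ∃ δ : (zdGraph 2).Walk f g', ∀ d ∈ δ.darts, sepEdge d.fst d.snd ∉ ω ∧ ∀ v ∈ sepEdge d.fst d.snd, R v := by
  obtain ⟨Ws, -, hWsd⟩ := exists_faceWalk_within_support Wd hmo hmi
  have h2' : ∀ d ∈ Ws.darts, sepEdge d.fst d.snd ∉ ω ∧ ∀ v ∈ sepEdge d.fst d.snd, R v := by
    intro d hd
    rcases hWsd d hd with h | h
    · exact h2 d h
    · have := h2 _ h; rwa [sepEdge_dart_symm] at this
  refine ⟨Uo.append (Ws.append (Ui.reverse.append Q)), fun d hd => ?_⟩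
  simp only [Walk.darts_append, List.mem_append] at hd
  rcases hd with hd | hd | hd | hd
  · exact h1 d hd
  · exact h2' d hd
  · exact sepEdge_forall_darts_reverse (P := fun e => e ∉ ω ∧ ∀ v ∈ e, R v) h3 d hd
  · exact h4 d hd

/-- Crossed edges of a face walk inside a face region lie above the lowest face row. [folklore] -/
theorem sepEdge_apply_one_ge_of_faces {a b : Site 2} (W : (zdGraph 2).Walk a b) {B : ℤ}
    (hW : ∀ z ∈ W.support, B ≤ z 1) {d : (zdGraph 2).Dart} (hd : d ∈ W.darts) {v : Site 2}
    (hv : v ∈ sepEdge d.fst d.snd) : B ≤ v 1 := by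
  have h1 := hW _ (W.dart_fst_mem_support_of_mem_darts hd)
  have := (sepEdge_apply_le hv).2.1
  have : d.fst 1 ≤ max (d.fst 1) (d.snd 1) := le_max_left _ _
  omega

/-- Crossed edges of a face walk inside a face region lie at most one above the highest face row. [folklore] -/
theorem sepEdge_apply_one_le_of_faces {a b : Site 2} (W : (zdGraph 2).Walk a b) {B : ℤ}
    (hW : ∀ z ∈ W.support, z 1 ≤ B) {d : (zdGraph 2).Dart} (hd : d ∈ W.darts) {v : Site 2}
    (hv : v ∈ sepEdge d.fst d.snd) : v 1 ≤ B + 1 := by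
  have h1 := hW _ (W.dart_fst_mem_support_of_mem_darts hd)
  have h2 := hW _ (W.dart_snd_mem_support_of_mem_darts hd)
  have := (sepEdge_apply_le hv).2.2
  have : max (d.fst 1) (d.snd 1) ≤ B := max_le h1 h2
  omega

set_option maxHeartbeats 800000 in
/-- **The glued top dual barrier of `(Q)`**: a walk of faces from the start face of the inner
event's top dual arm (face row `m₁ - 1`) to the end face of the outer event's top dual arm (face
row `n`), across closed edges none of which has an endpoint in `B(m₁ - 1)`. [cite: Nolin2008, §4.3, Prop. 12 (ii)] -/
theorem qBarrier_T (hm₁ : 128 ≤ m₁) (hM : 2 * m₁ ≤ M) {ω : BondConfig (Site 2)}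
    (A₁ : ZdSepDualArmT ω m₁ M 0 (m₁ / 64 : ℕ) 0 (M / 64 : ℕ)) (A₂ : ZdSepDualArmT ω (8 * M) n 0 ((8 * M) / 64 : ℕ) 0 (n / 64 : ℕ))
    (hT : ω ∈ dualFaceCrossing ![0, (M : ℤ) + 2] (M / 64 + 1) (7 * M - 4)) :
    ∃ δ : (zdGraph 2).Walk A₁.f A₂.g, ∀ d ∈ δ.darts, sepEdge d.fst d.snd ∉ ω ∧
      ∀ v ∈ sepEdge d.fst d.snd, v ∉ box 2 (m₁ - 1) := by
  have hm1 : 1 ≤ m₁ := by omega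
  have hE : 1 ≤ M / 8 := by omega
  have he8 : 1 ≤ (8 * M) / 8 := by omega
  have e8 : (((8 * M) / 8 : ℕ) : ℤ) = M := by omega
  have e64 : (((8 * M) / 64 : ℕ) : ℤ) = (M / 8 : ℕ) := by omega
  obtain ⟨a, b, Wd, ha, hb, hWds, hWdc⟩ := hT
  simp only [Matrix.cons_val_zero, Matrix.cons_val_one] at ha hb hWds
  have c1 : ((7 * M - 4 : ℕ) : ℤ) = 7 * M - 4 := by omega
  have c2 : ((M / 64 + 1 : ℕ) : ℤ) = (M / 64 : ℕ) + 1 := by push_cast; ring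
  rw [c1] at ha hWds; rw [c2] at hWds
  obtain ⟨mo, hmo, Uo, hUoc, hUol⟩ := A₁.exists_faceWalk_of_outerCorridor_loc (by simp) hE Wd.reverse (by rw [hb]; ring)
    (by rw [ha]; omega)
    (fun z hz => by
      rw [Walk.support_reverse, List.mem_reverse] at hz
      have := hWds z hz
      exact ⟨by omega, fun _ => ⟨this.1, by omega⟩⟩)
  obtain ⟨mi, hmi, Ui, hUic, hUil⟩ := A₂.exists_faceWalk_of_innerCorridor_loc (by simp) he8 Wd.reverse
    (by rw [ha]; push_cast; ring) (by rw [hb, e8]; push_cast; omega)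
    (fun z hz => by
      rw [Walk.support_reverse, List.mem_reverse] at hz
      have := hWds z hz
      rw [e8, e64]; push_cast
      exact ⟨by omega, fun _ => ⟨this.1, by omega⟩⟩)
  rw [Walk.support_reverse, List.mem_reverse] at hmo hmi
  -- located crossed edges, all outside `B(m₁ - 1)`
  have nb : ∀ v : Site 2, (m₁ : ℤ) ≤ v 1 → v ∉ box 2 (m₁ - 1) := by
    intro v hv hb'
    rw [mem_box, Fin.forall_fin_two] at hb'
    omega
  refine exists_composedDualArmQ (R := fun v => v ∉ box 2 (m₁ - 1)) Uo Wd hmo hmi Ui A₂.Q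
    (fun d hd => ⟨hUoc d hd, fun v hv => ?_⟩) (fun d hd => ⟨hWdc d hd, fun v hv => nb v ?_⟩)
    (fun d hd => ⟨hUic d hd, fun v hv => nb v ?_⟩) (fun d hd => ⟨A₂.hQc d hd, fun v hv => ?_⟩)
  · rcases hUol d hd v hv with h | h
    · rw [sqAnnulus, Finset.mem_coe, mem_annulus] at h; exact h.2
    · exact nb v (by omega)
  · have := sepEdge_apply_one_ge_of_faces Wd (fun z hz => (hWds z hz).2.2.1) hd hv; omega
  · have := hUil d hd v hv; rw [e8] at this; push_cast at this; omega
  · have h := A₂.hQa d hd v hv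
    rw [sqAnnulus, Finset.mem_coe, mem_annulus] at h
    intro hb'
    apply h.2
    rw [mem_box, Fin.forall_fin_two] at hb' ⊢
    omega

set_option maxHeartbeats 800000 in
/-- **The glued bottom dual barrier of `(Q)`** (mirror image). [cite: Nolin2008, §4.3, Prop. 12 (ii)] -/
theorem qBarrier_B (hm₁ : 128 ≤ m₁) (hM : 2 * m₁ ≤ M) {ω : BondConfig (Site 2)}
    (A₁ : ZdSepDualArmB ω m₁ M 0 (m₁ / 64 : ℕ) 0 (M / 64 : ℕ)) (A₂ : ZdSepDualArmB ω (8 * M) n 0 ((8 * M) / 64 : ℕ) 0 (n / 64 : ℕ))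
    (hB : ω ∈ dualFaceCrossing ![0, -(8 * (M : ℤ)) + 2] (M / 64 + 1) (7 * M - 4)) :
    ∃ δ : (zdGraph 2).Walk A₁.f A₂.g, ∀ d ∈ δ.darts, sepEdge d.fst d.snd ∉ ω ∧
      ∀ v ∈ sepEdge d.fst d.snd, v ∉ box 2 (m₁ - 1) := by
  have hm1 : 1 ≤ m₁ := by omega
  have hE : 1 ≤ M / 8 := by omega
  have he8 : 1 ≤ (8 * M) / 8 := by omega
  have e8 : (((8 * M) / 8 : ℕ) : ℤ) = M := by omega
  have e64 : (((8 * M) / 64 : ℕ) : ℤ) = (M / 8 : ℕ) := by omega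
  obtain ⟨a, b, Wd, ha, hb, hWds, hWdc⟩ := hB
  simp only [Matrix.cons_val_zero, Matrix.cons_val_one] at ha hb hWds
  have c1 : ((7 * M - 4 : ℕ) : ℤ) = 7 * M - 4 := by omega
  have c2 : ((M / 64 + 1 : ℕ) : ℤ) = (M / 64 : ℕ) + 1 := by push_cast; ring
  rw [c1] at ha hWds; rw [c2] at hWds
  obtain ⟨mo, hmo, Uo, hUoc, hUol⟩ := A₁.exists_faceWalk_of_outerCorridor_loc (by simp) hE Wd (by rw [ha]; ring)
    (by rw [hb]; omega)
    (fun z hz => by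
      have := hWds z hz
      exact ⟨by omega, fun _ => ⟨this.1, by omega⟩⟩)
  obtain ⟨mi, hmi, Ui, hUic, hUil⟩ := A₂.exists_faceWalk_of_innerCorridor_loc (by simp) he8 Wd
    (by rw [hb]; push_cast; ring) (by rw [ha, e8]; push_cast; omega)
    (fun z hz => by
      have := hWds z hz
      rw [e8, e64]; push_cast
      exact ⟨by omega, fun _ => ⟨this.1, by omega⟩⟩)
  have nb : ∀ v : Site 2, v 1 ≤ -(m₁ : ℤ) → v ∉ box 2 (m₁ - 1) := by
    intro v hv hb'
    rw [mem_box, Fin.forall_fin_two] at hb'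
    omega
  refine exists_composedDualArmQ (R := fun v => v ∉ box 2 (m₁ - 1)) Uo Wd hmo hmi Ui A₂.Q
    (fun d hd => ⟨hUoc d hd, fun v hv => ?_⟩) (fun d hd => ⟨hWdc d hd, fun v hv => nb v ?_⟩)
    (fun d hd => ⟨hUic d hd, fun v hv => nb v ?_⟩) (fun d hd => ⟨A₂.hQc d hd, fun v hv => ?_⟩)
  · rcases hUol d hd v hv with h | h
    · rw [sqAnnulus, Finset.mem_coe, mem_annulus] at h; exact h.2
    · exact nb v (by omega)
  · have := sepEdge_apply_one_le_of_faces Wd (fun z hz => (hWds z hz).2.2.2) hd hv; omega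
  · have := hUil d hd v hv; rw [e8] at this; push_cast at this; omega
  · have h := A₂.hQa d hd v hv
    rw [sqAnnulus, Finset.mem_coe, mem_annulus] at h
    intro hb'
    apply h.2
    rw [mem_box, Fin.forall_fin_two] at hb' ⊢
    omega

end QDualArms

/-! ### The glued event of `(Q)` is a five-arm event of `A_{m₁,n}` -/

section QInclusion

variable {m₁ M n : ℕ}

set_option maxHeartbeats 800000 in
/-- **`qGlued m₁ M n ⊆ zdFiveArmClusters m₁ n`** (for lattice configurations): the glued upper
right arm and the glued left arm are in distinct annulus-clusters (the two glued dual barriers and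
`not_openConnIn_sqAnnulus_of_dualArmsTB`), and the glued lower right arm is edge-disjoint from the
upper one (vertex-disjoint) and from the left one (distinct clusters again). [cite: Nolin2008, §4.3, Prop. 12 (ii)] -/
theorem mem_zdFiveArmClusters_of_mem_qGlued (hm₁ : 128 ≤ m₁) (hM : 2 * m₁ ≤ M) (hn : 16 * M ≤ n)
    {ω : BondConfig (Site 2)} (hωE : ω ⊆ (zdGraph 2).edgeSet) (hω : ω ∈ qGlued m₁ M n) :
    ω ∈ zdFiveArmClusters m₁ n := by
  obtain ⟨⟨⟨⟨⟨Ap₁, Am₁, hd₁⟩, ⟨AL₁⟩⟩, ⟨AT₁⟩, ⟨AB₁⟩⟩, ⟨⟨Ap₂, Am₂, hd₂⟩, ⟨AL₂⟩⟩, ⟨AT₂⟩, ⟨AB₂⟩⟩,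
    ⟨⟨⟨hR1, hR2⟩, hR3⟩, ⟨⟨hS1, hS2⟩, hS3⟩, hL⟩, hT, hB⟩ := hω
  have hm1 : 1 ≤ m₁ := by omega
  obtain ⟨W₁, hW₁e, hW₁s, hW₁c⟩ := qArm_Rpos hm₁ hM hn hωE Ap₁ Ap₂ hR1 hR2 hR3
  obtain ⟨W₃, hW₃e, hW₃s, hW₃c⟩ := qArm_Rneg hm₁ hM hn hωE Am₁ Am₂ hS1 hS2 hS3
  obtain ⟨W₂, hW₂e, hW₂s⟩ := qArm_L hm₁ hM hn hωE AL₁ AL₂ hL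
  obtain ⟨δ₁, hδ₁⟩ := qBarrier_T hm₁ hM AT₁ AT₂ hT
  obtain ⟨δ₂, hδ₂⟩ := qBarrier_B hm₁ hM AB₁ AB₂ hB
  have hx₁ := Ap₁.hx; have hx₃ := Am₁.hx; have hx₂ := AL₁.hx
  have hz₁ := Ap₂.hz; have hz₃ := Am₂.hz; have hz₂ := AL₂.hz
  have hf₁ := AT₁.hf; have hg₁ := AT₂.hg; have hf₂ := AB₁.hf; have hg₂ := AB₂.hg
  have barrier : ∀ {e : Site 2}, e 0 = m₁ → |e 1| ≤ (m₁ : ℤ) - 1 → ω ∉ openConnIn (sqAnnulus m₁ n) e AL₁.x := by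
    intro e he0 he1
    exact not_openConnIn_sqAnnulus_of_dualArmsTB (by omega) (by omega) hωE he0 he1 hx₂.1
      (by rw [abs_of_nonneg hx₂.2.1]; omega) δ₁ ⟨by omega, by omega, by omega⟩ (by omega) hδ₁
      δ₂ ⟨by omega, by omega, by omega⟩ (by omega) hδ₂
  refine ⟨Ap₁.x, AL₁.x, Am₁.x, Ap₂.z, AL₂.z, Am₂.z, W₁, W₂, W₃,
    mem_siteSphere_of_apply_zero hm1 (Or.inl hx₁.1) (abs_le.2 ⟨by omega, by omega⟩),
    mem_siteSphere_of_apply_zero hm1 (Or.inr hx₂.1) (abs_le.2 ⟨by omega, by omega⟩),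
    mem_siteSphere_of_apply_zero hm1 (Or.inl hx₃.1) (abs_le.2 ⟨by omega, by omega⟩),
    mem_siteSphere_of_apply_zero (by omega) (Or.inl hz₁.1) (abs_le.2 ⟨by omega, by omega⟩),
    mem_siteSphere_of_apply_zero (by omega) (Or.inr hz₂.1) (abs_le.2 ⟨by omega, by omega⟩),
    mem_siteSphere_of_apply_zero (by omega) (Or.inl hz₃.1) (abs_le.2 ⟨by omega, by omega⟩),
    hW₁s, hW₂s, hW₃s, hW₁e, hW₂e, hW₃e, fun e he₁ he₃ => ?_, fun e he₂ he₃ => ?_,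
    barrier hx₁.1 (by rw [abs_of_nonneg (by omega)]; omega)⟩
  · -- the two right arms share no edge: they share no vertex
    obtain ⟨v, hv⟩ : ∃ v, v ∈ e := ⟨e.out.1, Sym2.out_fst_mem e⟩
    exact qArms_disjoint hm₁ hM hn Ap₁ Am₁ hd₁ Ap₂ Am₂ hd₂ (hW₁c v (mem_support_of_mem_edges_of_mem W₁ he₁ hv))
      (hW₃c v (mem_support_of_mem_edges_of_mem W₃ he₃ hv))
  · -- the left arm and the lower right arm share no edge: they lie in distinct annulus-clusters
    obtain ⟨v, hv⟩ : ∃ v, v ∈ e := ⟨e.out.1, Sym2.out_fst_mem e⟩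
    have hv₂ := mem_support_of_mem_edges_of_mem W₂ he₂ hv
    have hv₃ := mem_support_of_mem_edges_of_mem W₃ he₃ hv
    apply barrier hx₃.1 (by rw [abs_of_nonpos (by omega)]; omega)
    refine mem_openConnIn_of_walk ((W₃.takeUntil v hv₃).append (W₂.takeUntil v hv₂).reverse) (fun z hz => ?_) (fun e' he' => ?_)
    · rw [Walk.mem_support_append_iff, Walk.support_reverse, List.mem_reverse] at hz
      rcases hz with hz | hz
      · exact hW₃s z (W₃.support_takeUntil_subset_support hv₃ hz)
      · exact hW₂s z (W₂.support_takeUntil_subset_support hv₂ hz)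
    · rw [Walk.edges_append, List.mem_append, Walk.edges_reverse, List.mem_reverse] at he'
      rcases he' with he' | he'
      · exact hW₃e e' (W₃.edges_takeUntil_subset_edges hv₃ he')
      · exact hW₂e e' (W₂.edges_takeUntil_subset_edges hv₂ he')

/-- **The gluing inequality of `(Q)`**: for `128 ≤ m₁`, `2 m₁ ≤ M`, `16 M ≤ n` and the RSW constant
`c` of aspect ratio `1024`,
`c⁹ · P(zdFiveArmSep m₁ M) · P(zdFiveArmSep (8M) n) ≤ P(zdFiveArmClusters m₁ n)`. [cite: Nolin2008, §4.3, Prop. 12 (ii); KestenScalingCMP1987, Lemma 6] -/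
theorem real_zdFiveArmSep_mul_le_real_zdFiveArmClusters (hm₁ : 128 ≤ m₁) (hM : 2 * m₁ ≤ M) (hn : 16 * M ≤ n)
    {c : ℝ} (hc0 : 0 < c) (hc : ∀ l : ℕ, 1 ≤ l → c ≤ crossingProb half (1024 * l - 1) (l - 1)) :
    c ^ 9 * ((bondPercolation (zdGraph 2) half).real (zdFiveArmSep m₁ M) *
        (bondPercolation (zdGraph 2) half).real (zdFiveArmSep (8 * M) n)) ≤
      (bondPercolation (zdGraph 2) half).real (zdFiveArmClusters m₁ n) := by
  refine (real_qGlued_ge hm₁ hM hn hc0 hc).trans ?_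
  refine ENNReal.toReal_mono (measure_ne_top _ _) (measure_mono_ae ?_)
  filter_upwards [ae_subset_edgeSet (zdGraph 2) half] with ω hωE hω
  exact mem_zdFiveArmClusters_of_mem_qGlued hm₁ hM hn hωE hω

end QInclusion

/-! ### Quasi-multiplicativity -/

section QuasiMult

/-- **A-priori lower bound at bounded ratio** from the five-arm lower bound at well-spaced radii
(`h5`) and monotonicity: for `1 ≤ r ≤ R ≤ 512 r`,
`cL / max(512, A)² ≤ P(zdFiveArmClusters r R)`. [cite: Nolin2008, §5.2, Thm. 24 (ii)] -/
theorem real_zdFiveArmClusters_ge_of_ratio {A : ℕ} {cL : ℝ} (hcL : 0 < cL)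
    (h5 : ∀ r R : ℕ, 1 ≤ r → A * r ≤ R →
      cL * ((r : ℝ) / R) ^ 2 ≤ (bondPercolation (zdGraph 2) half).real (zdFiveArmClusters r R))
    {r R : ℕ} (hr : 1 ≤ r) (hrR : r ≤ R) (hR : R ≤ 512 * r) :
    cL / ((max 512 A : ℕ) : ℝ) ^ 2 ≤ (bondPercolation (zdGraph 2) half).real (zdFiveArmClusters r R) := by
  set R' := max R (A * r) with hR'
  have h1 := h5 r R' hr (le_max_right _ _)
  have h2 : (bondPercolation (zdGraph 2) half).real (zdFiveArmClusters r R') ≤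
      (bondPercolation (zdGraph 2) half).real (zdFiveArmClusters r R) :=
    real_zdFiveArmClusters_mono half le_rfl hrR (le_max_left _ _)
  refine le_trans ?_ (h1.trans h2)
  have hR'le : (R' : ℝ) ≤ ((max 512 A : ℕ) : ℝ) * r := by
    have : R' ≤ max 512 A * r := by
      rw [hR']
      refine max_le ?_ ?_
      · exact hR.trans (Nat.mul_le_mul_right _ (le_max_left _ _))
      · exact Nat.mul_le_mul_right _ (le_max_right _ _)
    exact_mod_cast this
  have hr0 : (0 : ℝ) < r := by exact_mod_cast hr
  have hR'0 : (0 : ℝ) < R' := by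
    have : 1 ≤ R' := hr.trans (hrR.trans (le_max_left _ _))
    exact_mod_cast this
  have hK : (0 : ℝ) < ((max 512 A : ℕ) : ℝ) := by
    have : 1 ≤ max 512 A := le_trans (by norm_num) (le_max_left _ _)
    exact_mod_cast (show 0 < max 512 A by omega)
  -- `1 / max(512, A) ≤ r / R'`
  have hq : 1 / ((max 512 A : ℕ) : ℝ) ≤ (r : ℝ) / R' := by
    rw [div_le_div_iff₀ hK hR'0]
    linarith
  have hq' : (1 / ((max 512 A : ℕ) : ℝ)) ^ 2 ≤ ((r : ℝ) / R') ^ 2 :=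
    pow_le_pow_left₀ (by positivity) hq 2
  calc cL / ((max 512 A : ℕ) : ℝ) ^ 2 = cL * (1 / ((max 512 A : ℕ) : ℝ)) ^ 2 := by
        rw [one_div_pow, mul_one_div]
    _ ≤ cL * ((r : ℝ) / R') ^ 2 := mul_le_mul_of_nonneg_left hq' hcL.le

set_option maxHeartbeats 800000 in
/-- **Quasi-multiplicativity of the five-arm probability from Kesten's separation theorem**
(Nolin 2008, Prop. 12 (ii) and Prop. 16; DMT 2021, Prop. 6.3, `q = 1`): if
`cs · P(zdFiveArmClusters n N) ≤ P(zdFiveArmSep n N)` for `m₁ ≤ n`, `2n ≤ N` (`m₁ ≥ 128`), and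
`cL (r/R)² ≤ P(zdFiveArmClusters r R)` for `1 ≤ r`, `A r ≤ R`, then for some `c > 0` and all
`m₁ ≤ m ≤ n`, `c · P(T̃(m₁, m)) · P(T̃(m, n)) ≤ P(T̃(m₁, n))` (`T̃ = zdFiveArmClusters`).  The main
case `2m₁ ≤ m`, `16 m ≤ n` is the gluing inequality with `M = m` and `T̃(m, n) ⊆ T̃(8m, n)`; the
bounded-ratio cases use `h5`. [cite: Nolin2008, §4.4, Prop. 16 and §4.3, Prop. 12 (ii)] [cite: DuminilCopinManolescuTassion2021, §6.2, Prop. 6.3] -/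
theorem zdFiveArm_quasiMult_of_separation {m₁ : ℕ} (hm₁ : 128 ≤ m₁) {cs : ℝ} (hcs : 0 < cs)
    (hsep : ∀ n N : ℕ, m₁ ≤ n → 2 * n ≤ N →
      cs * (bondPercolation (zdGraph 2) half).real (zdFiveArmClusters n N) ≤
        (bondPercolation (zdGraph 2) half).real (zdFiveArmSep n N))
    {A : ℕ} {cL : ℝ} (hcL : 0 < cL)
    (h5 : ∀ r R : ℕ, 1 ≤ r → A * r ≤ R →
      cL * ((r : ℝ) / R) ^ 2 ≤ (bondPercolation (zdGraph 2) half).real (zdFiveArmClusters r R)) :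
    ∃ c : ℝ, 0 < c ∧ ∀ m n : ℕ, m₁ ≤ m → m ≤ n →
      c * (bondPercolation (zdGraph 2) half).real (zdFiveArmClusters m₁ m) *
          (bondPercolation (zdGraph 2) half).real (zdFiveArmClusters m n) ≤
        (bondPercolation (zdGraph 2) half).real (zdFiveArmClusters m₁ n) := by
  obtain ⟨c, hc0, hc⟩ := rsw_lowerBound_holds 1024 (by norm_num)
  set μ := bondPercolation (zdGraph 2) half with hμ
  set K := fun m n : ℕ => μ.real (zdFiveArmClusters m n) with hK
  set c₀ := c ^ 9 * cs ^ 2 with hc₀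
  have hc₀0 : 0 < c₀ := by positivity
  set q := cL / ((max 512 A : ℕ) : ℝ) ^ 2 with hq
  have hq0 : 0 < q := by
    have : (0 : ℝ) < ((max 512 A : ℕ) : ℝ) := by exact_mod_cast (show 0 < max 512 A by omega)
    positivity
  have hm1 : 1 ≤ m₁ := by omega
  -- the gluing inequality combined with separation
  have main : ∀ M n : ℕ, 2 * m₁ ≤ M → 16 * M ≤ n → c₀ * K m₁ M * K (8 * M) n ≤ K m₁ n := by
    intro M n hM hn
    have h := real_zdFiveArmSep_mul_le_real_zdFiveArmClusters hm₁ hM hn hc0 hc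
    have h1 := hsep m₁ M le_rfl hM
    have h2 := hsep (8 * M) n (by omega) (by omega)
    have hK1 : 0 ≤ K m₁ M := measureReal_nonneg
    have hK2 : 0 ≤ K (8 * M) n := measureReal_nonneg
    calc c₀ * K m₁ M * K (8 * M) n = c ^ 9 * ((cs * K m₁ M) * (cs * K (8 * M) n)) := by rw [hc₀]; ring
      _ ≤ c ^ 9 * (μ.real (zdFiveArmSep m₁ M) * μ.real (zdFiveArmSep (8 * M) n)) :=
          mul_le_mul_of_nonneg_left (mul_le_mul h1 h2 (by positivity) measureReal_nonneg) (by positivity)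
      _ ≤ K m₁ n := h
  -- bounded-ratio lower bound
  have low : ∀ r R : ℕ, 1 ≤ r → r ≤ R → R ≤ 512 * r → q ≤ K r R :=
    fun r R hr hrR hR => real_zdFiveArmClusters_ge_of_ratio hcL h5 hr hrR hR
  have q_le_one : q ≤ 1 := (low 1 1 le_rfl le_rfl (by norm_num)).trans measureReal_le_one
  have Kle : ∀ m n, K m n ≤ 1 := fun m n => measureReal_le_one
  have K0 : ∀ m n, 0 ≤ K m n := fun m n => measureReal_nonneg
  refine ⟨min c₀ 1 * q, by positivity, fun m n hm hmn => ?_⟩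
  have hmin0 : 0 ≤ min c₀ 1 := le_min hc₀0.le zero_le_one
  have hcc : min c₀ 1 * q ≤ c₀ * q := mul_le_mul_of_nonneg_right (min_le_left _ _) hq0.le
  have hcq : min c₀ 1 * q ≤ q := by
    calc min c₀ 1 * q ≤ 1 * q := mul_le_mul_of_nonneg_right (min_le_right _ _) hq0.le
      _ = q := one_mul q
  have hcc₀ : min c₀ 1 * q ≤ c₀ := by
    calc min c₀ 1 * q ≤ c₀ * q := hcc
      _ ≤ c₀ * 1 := mul_le_mul_of_nonneg_left q_le_one hc₀0.le
      _ = c₀ := mul_one c₀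
  have hc0' : 0 ≤ min c₀ 1 * q := mul_nonneg hmin0 hq0.le
  by_cases hA : 2 * m₁ ≤ m
  · by_cases hB : 16 * m ≤ n
    · -- main case, `M = m`
      have h := main m n hA hB
      have hmono : K m n ≤ K (8 * m) n := real_zdFiveArmClusters_mono half (by omega) (by omega) le_rfl
      calc min c₀ 1 * q * K m₁ m * K m n ≤ c₀ * K m₁ m * K (8 * m) n :=
            mul_le_mul (mul_le_mul_of_nonneg_right hcc₀ (K0 _ _)) hmono (K0 _ _) (mul_nonneg hc₀0.le (K0 _ _))
        _ ≤ K m₁ n := h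
    · have hB' := not_le.1 hB
      by_cases hC : 32 * m₁ ≤ m
      · -- `M = m / 16`
        have h := main (m / 16) n (by omega) (by omega)
        have hmono : K m₁ m ≤ K m₁ (m / 16) := real_zdFiveArmClusters_mono half le_rfl (by omega) (by omega)
        have hlow := low (8 * (m / 16)) n (by omega) (by omega) (by omega)
        calc min c₀ 1 * q * K m₁ m * K m n ≤ c₀ * q * K m₁ m * 1 :=
              mul_le_mul (mul_le_mul_of_nonneg_right hcc (K0 _ _)) (Kle _ _) (K0 _ _)
                (mul_nonneg (mul_nonneg hc₀0.le hq0.le) (K0 _ _))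
          _ = c₀ * K m₁ m * q := by ring
          _ ≤ c₀ * K m₁ (m / 16) * K (8 * (m / 16)) n :=
              mul_le_mul (mul_le_mul_of_nonneg_left hmono hc₀0.le) hlow hq0.le (mul_nonneg hc₀0.le (K0 _ _))
          _ ≤ K m₁ n := h
      · have hC' := not_le.1 hC
        have hlow := low m₁ n hm1 (by omega) (by omega)
        calc min c₀ 1 * q * K m₁ m * K m n ≤ q * 1 * 1 :=
              mul_le_mul (mul_le_mul hcq (Kle _ _) (K0 _ _) hq0.le) (Kle _ _) (K0 _ _) (by positivity)
          _ = q := by ring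
          _ ≤ K m₁ n := hlow
  · have hA' := not_le.1 hA
    by_cases hB : 32 * m₁ ≤ n
    · -- `M = 2 m₁`
      have h := main (2 * m₁) n le_rfl (by omega)
      have hmono : K m n ≤ K (8 * (2 * m₁)) n := real_zdFiveArmClusters_mono half (by omega) (by omega) le_rfl
      have hlow := low m₁ (2 * m₁) hm1 (by omega) (by omega)
      calc min c₀ 1 * q * K m₁ m * K m n ≤ c₀ * q * 1 * K (8 * (2 * m₁)) n :=
            mul_le_mul (mul_le_mul hcc (Kle _ _) (K0 _ _) (by positivity)) hmono (K0 _ _) (by positivity)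
        _ = c₀ * q * K (8 * (2 * m₁)) n := by ring
        _ ≤ c₀ * K m₁ (2 * m₁) * K (8 * (2 * m₁)) n :=
            mul_le_mul_of_nonneg_right (mul_le_mul_of_nonneg_left hlow hc₀0.le) (K0 _ _)
        _ ≤ K m₁ n := h
    · have hB' := not_le.1 hB
      have hlow := low m₁ n hm1 (by omega) (by omega)
      calc min c₀ 1 * q * K m₁ m * K m n ≤ q * 1 * 1 :=
            mul_le_mul (mul_le_mul hcq (Kle _ _) (K0 _ _) hq0.le) (Kle _ _) (K0 _ _) (by positivity)
        _ = q := by ring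
        _ ≤ K m₁ n := hlow

end QuasiMult

end Literature.Probability.Percolation
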